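import Literature.Probability.RandomPlanarGeometry.HexSAWPolygonStepTwoYStar
import HarnessLib

/-!
# The step `2` for honeycomb polygon numbers at TWO corners: the bottom-corner surgeries X♭ / `Y⋆♭` and the injection
# `#{X ∪ Y⋆ ∪ (leaf ∩ bottom-served)} ≤ q_{N+2}(ℍ)`

Topic `Literature/Probability/RandomPlanarGeometry` (lane «pcv-sawmu», a-p4 g19; sequel of `HexSAWPolygonStepTwoYStar.lean` — the top
surgeries (class X, roof move `Y⋆`), `IsStepTwoRoof`, `IsTopLeaf`, `RoofDatum`, `exists_stepTwoRoof_image`, `eq_of_stepTwoRoof_image_eq`,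
`isStepTwoRoof_or_isTopLeaf` —, of `HexSAWPolygonStepTwoMain.lean` — `spliceAdd`, `SpliceAddOK`, `spliceAddOK_of_tables`,
`eq_of_spliceAdd_eq`, `spliceX_signature_fwd/bwd`, `topAt_spliceX` — and of `HexSAWPolygonStepSix.lean` — `tpath`, `rd`, `TopSix`,
`topAt_unique`, `tpath_mem`, `w6A`).

The top-corner surgeries of the lane leave the LEAF class — the top-right hexagon hangs on its lower-left neighbour only.  The natural
second move is the MIRROR IMAGE of the same surgeries at the BOTTOM corner `(xb, L)` = the largest abscissa on the LOWEST row of vertices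
(Madras–Slade's surgery is stated at the lexicographically largest vertex; any extreme vertex works the same way
[MadrasSlade1993, §3.2, proof of Theorem 3.2.3]).  On the canonically rooted polygons `canonEnd n` (root = lexicographically smallest site
`(0,0)`, first step up) the bottom corner is never the root and the mirrored surgeries never create a site lexicographically below the
root (`xb ≥ 2` always; `xb ≥ 4` in class X♭), so NO re-rooting is needed — this is what makes the bottom corner the right second anchor
in this frame.  When the bottom row is the root row (`L = 0`) the root edge `{(0,0),(1,0)}` cuts it: the class-X♭ window may end at the end
`e₀ = (1,0)` of the walk, and at the corner `(2,0)` next to `e₀` the sites beyond the corner wrap around the root — both are handled by local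
parity / injectivity arguments (`caseAb_fwd/bwd`, the conditional post-window data of the backward floor move; at the corner `(2,0)` the
floor move applies for every `n ≥ 6`).

PART I (bottom corner): `exists_bottom_corner`, `bottom_corner_pred/succ` (the corner `(xb,L)`, `L ≤ 0`, `xb ≥ 2`, parity `xb + L` even,
walk-neighbours `(xb−1,L)` and `(xb,L+1)`), `BotSix` / `botAt_unique` / `botAt_spliceAdd`, `ne_of_low`; the mirrored tables `offXb`,
`offYsb k`, `wYsb` (height offsets negated), `spliceOK_Xb` / `spliceOK_Ysb` and canonicity of the images, freshness `caseYb_free`, the forced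
FLOOR run `exists_floor_run_fwd/bwd` (above the bottom corner a walk stepping up and then RIGHT runs along the row `L+1` for an odd number of
steps and then steps UP), `caseAb_fwd/bwd`, `notXb_pred_fwd/succ_bwd`, `apply_two_of_mem_canonEnd`, the classification
`stepTwo_classify_bottom` (class X♭, floor move, or BOTTOM LEAF), image corners `botAt_spliceXb` (`(xb−1,L−1)`) / `botAt_spliceYsb` (`(xb+2k,L)`), site and height lemmas, and
the decoding `spliceXb_decode`, `spliceYsb_decode`, `spliceXb_ne_spliceYsb`.

PART II (the two-corner injection).  Map `ω ∈ canonEnd n` (`n ≥ 5`) to its top image when `ω` is of class X ∪ Y⋆; otherwise `ω` is in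
the leaf class, and if its bottom configuration is X♭ (with at least two rows of hexagons) or a floor run (with at least three rows)
(`IsStepTwoBottom`), map it to its bottom image (`BottomDatum`, `exists_stepTwoBottom_image`,
`eq_of_stepTwoBottom_image_eq`).  Injectivity across the two kinds of images: `not_isTopLeaf_of_roofDatum` (a top image is never in the
leaf class at ITS top corner: below the corner of a case-X image the walk turns right; a roof image has the site `(x'−3, H')` on it) and
`isTopLeaf_of_bottomDatum` (the bottom surgery changes sites at heights `≤ L` (X♭) / `≤ L + 1` (floor) `< H − 1` only, so a bottom
image of a leaf polygon is again in the leaf class).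
★ **`card_filter_isStepTwoTwoCorner_le : 5 ≤ n → #{ω ∈ canonEnd n | IsStepTwoTwoCorner n ω} ≤ #canonEnd (n+2)`** with
`IsStepTwoTwoCorner n ω := IsStepTwoRoof n ω ∨ (IsTopLeaf n ω ∧ IsStepTwoBottom n ω)`; the complement form
`card_canonEnd_sub_card_filter_twoCornerResidue_le`, `hexPolygonNumber_sub_card_twoCornerResidue_le` (residue = leaf ∧ not
bottom-served: the bottom-right hexagon is itself a down-right leaf — or the polygon has one row, or two rows and a floor run, which
for the leaf class means the dihexagon);
`card_filter_isStepTwoRoof_le_card_filter_isStepTwoTwoCorner` (the class contains #502's, hence #441's).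

NOT claimed: `q_N(ℍ) ≤ q_{N+2}(ℍ)`.  Numerically (lane scripts `HOME/pub-sawmu-a-p4/g19/two/py/`, door note addendum g19 §3) the
two-corner residue is 1, 0, 3, 2, 14, 22, 89, 192, 663 of 12, 18, 65, 138, 432, 1074, 3231, 8718, 25999 for `N = 14, …, 30` (≈ 2.5 %,
down from ≈ 16 % for the leaf class of #502 and ≈ 30 % for the residue of #441) — exactly the polygons whose top-right hexagon is an
up-right leaf AND whose bottom-right hexagon is a down-right leaf (edition 1 of this file asked for three rows in case X♭ as well and
left 1, 0, 2, 1, 4, 3, 8, 8, 17 two-row polygons aside).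
Label (lane): LANE LEMMA / infrastructure for an open combinatorial item; no literature claim beyond the transplanted `ℤ^d` method.
-/

noncomputable section

open Finset Function Literature.Probability.LatticeModels Literature.Probability.Percolation SimpleGraph

namespace Literature.Probability.RandomPlanarGeometry.SAW

namespace HexBW

namespace PolygonConcat

variable {n : ℕ} {ω : ℕ → Site 2}

/-- Two sites of `ℤ²` are equal iff both coordinates agree. [folklore; lane plumbing] [cite: MadrasSlade1993, §1.1] -/
private theorem bt_site_eq_iff {x y : Site 2} : x = y ↔ x 0 = y 0 ∧ x 1 = y 1 := by
  constructor
  · rintro rfl; exact ⟨rfl, rfl⟩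
  · rintro ⟨h0, h1⟩; funext i; fin_cases i <;> assumption

/-- `pt a b` is lexicographically `≥ 0` when `a > 0`, or `a = 0 ≤ b`. [cite: MadrasSlade1993, §3.2 (proof of Theorem 3.2.3: `Q[N]`)] -/
private theorem bt_lexNonneg_pt {a b : ℤ} (h : 0 < a ∨ (a = 0 ∧ 0 ≤ b)) : LexNonneg (pt a b) := by
  unfold LexNonneg; simpa using h

/-! ### The bottom corner -/

section BottomCorner

/-- **The bottom corner of a canonical polygon.**  For `ω ∈ canonEnd n`, `n ≥ 2`: there are `L ≤ 0` (the minimal height), `xb ≥ 2` (the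
largest abscissa on the bottom row of vertices) and a time `1 ≤ i₀ ≤ n − 1` with `ω i₀ = (xb, L)`, such that the walk-neighbours of
`(xb, L)` are `(xb−1, L)` and `(xb, L+1)` — in one of the two orders.  (The root `(0,0)` and the end `e₀ = (1,0)` are never the bottom
corner: `e₀` lies on the row `0` right of the root, and `(1,0)` has no upward bond.)
[cite: MadrasSlade1993, §3.2 (proof of Theorem 3.2.3: the surgery at an extreme point)] -/
theorem exists_bottom_corner (hω : ω ∈ canonEnd n) (hn : 2 ≤ n) :
    ∃ (L xb : ℤ) (i₀ : ℕ), 1 ≤ i₀ ∧ i₀ + 1 ≤ n ∧ ω i₀ = pt xb L ∧ L ≤ 0 ∧ 2 ≤ xb ∧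
      (∀ i, i ≤ n → L ≤ ω i 1) ∧ (∀ i, i ≤ n → ω i 1 = L → ω i 0 ≤ xb) ∧
      ((ω (i₀ - 1) = pt (xb - 1) L ∧ ω (i₀ + 1) = pt xb (L + 1)) ∨
        (ω (i₀ + 1) = pt (xb - 1) L ∧ ω (i₀ - 1) = pt xb (L + 1))) := by
  classical
  obtain ⟨hE, hlex⟩ := mem_canonEnd.1 hω
  obtain ⟨⟨h0, -, hbw, hinj⟩, hn'⟩ := mem_endAt_iff.1 hE
  -- the minimal height `L`
  obtain ⟨i₁, hi₁, hmin₁⟩ := exists_min_image (range (n + 1)) (fun i => ω i 1) ⟨0, by simp⟩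
  simp only [mem_range, Nat.lt_succ_iff] at hi₁ hmin₁
  set L : ℤ := ω i₁ 1 with hL
  have hL0 : L ≤ 0 := by have := hmin₁ 0 (by omega); rw [h0] at this; simpa using this
  -- the largest abscissa on the bottom row
  set S : Finset ℕ := (range (n + 1)).filter fun i => ω i 1 = L with hS
  have hSne : S.Nonempty := ⟨i₁, by rw [hS, Finset.mem_filter, Finset.mem_range]; exact ⟨by omega, hL.symm⟩⟩
  obtain ⟨i₀, hi₀S, hmax₀⟩ := exists_max_image S (fun i => ω i 0) hSne
  have hi₀ : i₀ ≤ n ∧ ω i₀ 1 = L := by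
    rw [hS, Finset.mem_filter, Finset.mem_range] at hi₀S; exact ⟨by omega, hi₀S.2⟩
  set xb : ℤ := ω i₀ 0 with hxb
  have hminH : ∀ i, i ≤ n → L ≤ ω i 1 := hmin₁
  have hmaxX : ∀ i, i ≤ n → ω i 1 = L → ω i 0 ≤ xb := fun i hi hiL =>
    hmax₀ i (by rw [hS, Finset.mem_filter, Finset.mem_range]; exact ⟨by omega, hiL⟩)
  have hv : ω i₀ = pt xb L := by rw [bt_site_eq_iff, pt_apply_zero, pt_apply_one]; exact ⟨rfl, hi₀.2⟩
  -- lexicographic facts: every site has `x ≥ 0`, and `x = 0` forces `y ≥ 0`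
  have hlex0 : ∀ i, i ≤ n → 0 ≤ ω i 0 ∧ (ω i 0 = 0 → 0 ≤ ω i 1) := by
    intro i hi; have h := hlex i hi; unfold LexNonneg at h; constructor <;> [omega; (intro h'; omega)]
  -- `xb ≥ 1`: if `L = 0` the end `e₀ = (1,0)` is on the bottom row; if `L < 0` a site of negative height has `x ≥ 1`
  have hxb1 : 1 ≤ xb := by
    rcases eq_or_lt_of_le hL0 with hL0' | hLneg
    · have := hmaxX n le_rfl (by rw [hn']; simpa using hL0'.symm); rw [hn'] at this; simpa using this
    · have h := hlex0 i₀ hi₀.1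
      by_contra hlt
      have hx0 : ω i₀ 0 = 0 := by omega
      have := h.2 hx0; rw [hi₀.2] at this; omega
  -- `i₀ ≠ 0, n`
  have hi₀0 : i₀ ≠ 0 := by rintro rfl; rw [h0] at hxb; simp at hxb; omega
  have hi₀n : i₀ ≠ n := by
    intro heq
    -- the corner would be `e₀ = (1,0)`: `L = 0`, `xb = 1`; its predecessor is a site adjacent to `(1,0)`, of height `≥ 0`,
    -- not right of it on the row `0`: only `(0,0) = ω 0` (no vertical bond up at the odd site `(1,0)`) — so `n − 1 = 0`
    have hxb' : xb = 1 := by rw [hxb, heq, hn']; simp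
    have hL' : L = 0 := by rw [← hi₀.2, heq, hn']; simp
    have hadj : brickWallGraph.Adj (ω (n - 1)) (ω n) := by
      have := hbw (n - 1) (by omega); rwa [show n - 1 + 1 = n by omega] at this
    rw [hn'] at hadj
    have hzL := hminH (n - 1) (by omega)
    have hzX := hmaxX (n - 1) (by omega)
    rw [hL'] at hzL hzX; rw [hxb'] at hzX
    rcases adj_cases hadj.symm with ⟨hz0, hz1⟩ | ⟨hz0, hz1⟩ | hz0
    · simp at hz0 hz1; have := hzX hz1; omega
    · simp at hz0 hz1
      have : ω (n - 1) = ω 0 := by rw [h0, bt_site_eq_iff]; simp; omega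
      have := hinj (show n - 1 ∈ {i | i ≤ n} by simp) (show 0 ∈ {i | i ≤ n} by simp) this; omega
    · rcases vertical_cases hadj.symm hz0 with ⟨hy, hp⟩ | ⟨hy, hp⟩
      · simp at hp
      · simp at hy hz0; omega
  -- a walk-neighbour of `ω i₀` is the left or the up neighbour
  have key : ∀ z : Site 2, brickWallGraph.Adj (ω i₀) z → (∃ i, i ≤ n ∧ ω i = z) →
      (z = pt (xb - 1) L) ∨ (z = pt xb (L + 1)) := by
    intro z hadj ⟨i, hi, hiz⟩
    have hzL : L ≤ z 1 := by rw [← hiz]; exact hminH i hi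
    rcases adj_cases hadj with ⟨h1', h2'⟩ | ⟨h1', h2'⟩ | h1'
    · have := hmaxX i hi (by rw [hiz, h2', hi₀.2]); rw [hiz] at this; omega
    · left; rw [bt_site_eq_iff, pt_apply_zero, pt_apply_one]; exact ⟨by omega, by rw [h2', hi₀.2]⟩
    · rcases vertical_cases hadj h1' with ⟨hy, -⟩ | ⟨hy, -⟩
      · right; rw [bt_site_eq_iff, pt_apply_zero, pt_apply_one]; exact ⟨by rw [h1'], by rw [hi₀.2] at hy; omega⟩
      · rw [hi₀.2] at hy; omega
  have hpred_adj : brickWallGraph.Adj (ω i₀) (ω (i₀ - 1)) := by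
    have := hbw (i₀ - 1) (by omega); rw [show i₀ - 1 + 1 = i₀ by omega] at this; exact this.symm
  have hsucc_adj : brickWallGraph.Adj (ω i₀) (ω (i₀ + 1)) := hbw i₀ (by omega)
  have hne : ω (i₀ - 1) ≠ ω (i₀ + 1) := by
    intro h
    have := hinj (show i₀ - 1 ∈ {i | i ≤ n} by simp; omega) (show i₀ + 1 ∈ {i | i ≤ n} by simp; omega) h
    omega
  have hp := key _ hpred_adj ⟨i₀ - 1, by omega, rfl⟩
  have hs := key _ hsucc_adj ⟨i₀ + 1, by omega, rfl⟩
  -- `xb ≥ 2`: the left neighbour `(xb−1, L)` is a site, hence lexicographically `≥ 0`; `xb = 1` would force `L = 0` and the corner `e₀`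
  have hleft : ∃ i, i ≤ n ∧ ω i = pt (xb - 1) L := by
    rcases hp with hp | hp
    · exact ⟨i₀ - 1, by omega, hp⟩
    · rcases hs with hs | hs
      · exact ⟨i₀ + 1, by omega, hs⟩
      · exact absurd (hp.trans hs.symm) hne
  have hxb2 : 2 ≤ xb := by
    obtain ⟨i, hi, hiz⟩ := hleft
    have h := hlex0 i hi; rw [hiz] at h; simp only [pt_apply_zero, pt_apply_one] at h
    by_contra hlt
    have hx : xb = 1 := by omega
    have hL' : L = 0 := le_antisymm hL0 (h.2 (by omega))
    have : ω i₀ = ω n := by rw [hv, hn', hx, hL']; ext j; fin_cases j <;> simp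
    exact hi₀n (hinj (show i₀ ∈ {i | i ≤ n} by simp; omega) (show n ∈ {i | i ≤ n} by simp) this)
  refine ⟨L, xb, i₀, by omega, by omega, hv, hL0, hxb2, hminH, hmaxX, ?_⟩
  rcases hp with hp | hp <;> rcases hs with hs | hs
  · exact absurd (hp.trans hs.symm) hne
  · exact Or.inl ⟨hp, hs⟩
  · exact Or.inr ⟨hs, hp⟩
  · exact absurd (hp.trans hs.symm) hne

/-- **Parity at the bottom corner**: the vertical bond at `(xb, L)` goes up, so `xb + L` is even; hence `(xb−1, L)` has no upward bond, its
downward one leaves the polygon's rows, and its walk-neighbour other than `(xb, L)` is `(xb−2, L)`.  Forward form: if `ω (i₀−1) = (xb−1, L)`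
then `2 ≤ i₀` and `ω (i₀−2) = (xb−2, L)`. [cite: EntingJensen2009, §7.4.2, Fig. 7.10 (brickwork form of the honeycomb lattice)] -/
theorem bottom_corner_pred (hω : ω ∈ canonEnd n) {L xb : ℤ} {i₀ : ℕ} (hi₀ : 1 ≤ i₀) (hi₀n : i₀ + 1 ≤ n)
    (hv : ω i₀ = pt xb L) (hxb : 2 ≤ xb) (hminH : ∀ i, i ≤ n → L ≤ ω i 1)
    (hp : ω (i₀ - 1) = pt (xb - 1) L) (hs : ω (i₀ + 1) = pt xb (L + 1)) :
    2 ≤ i₀ ∧ ω (i₀ - 2) = pt (xb - 2) L := by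
  obtain ⟨hE, hlex⟩ := mem_canonEnd.1 hω
  obtain ⟨⟨h0, -, hbw, hinj⟩, hn'⟩ := mem_endAt_iff.1 hE
  have hvert := vertical_cases (hbw i₀ (by omega)) (by rw [hv, hs]; simp)
  have hpar : (xb + L) % 2 = 0 := by
    rw [hv, hs] at hvert; simp only [pt_apply_zero, pt_apply_one] at hvert; omega
  have hi₀2 : 2 ≤ i₀ := by
    by_contra hlt
    have hi : i₀ = 1 := by omega
    rw [hi] at hp; simp only [Nat.sub_self] at hp
    rw [h0] at hp
    have := congrFun hp 0; simp at this; omega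
  refine ⟨hi₀2, ?_⟩
  have hadj : brickWallGraph.Adj (ω (i₀ - 1)) (ω (i₀ - 2)) := by
    have := hbw (i₀ - 2) (by omega); rw [show i₀ - 2 + 1 = i₀ - 1 by omega] at this; exact this.symm
  have hne : ω (i₀ - 2) ≠ ω i₀ := by
    intro h
    have := hinj (show i₀ - 2 ∈ {i | i ≤ n} by simp; omega) (show i₀ ∈ {i | i ≤ n} by simp; omega) h
    omega
  have hzL : L ≤ ω (i₀ - 2) 1 := hminH _ (by omega)
  rw [hp] at hadj
  rcases adj_cases hadj with ⟨h1', h2'⟩ | ⟨h1', h2'⟩ | h1'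
  · exfalso; apply hne; rw [hv, bt_site_eq_iff]; simp only [pt_apply_zero, pt_apply_one] at h1' h2' ⊢; exact ⟨by omega, by omega⟩
  · rw [bt_site_eq_iff]; simp only [pt_apply_zero, pt_apply_one] at h1' h2' ⊢; exact ⟨by omega, by omega⟩
  · exfalso
    rcases vertical_cases hadj h1' with ⟨hy, hpar'⟩ | ⟨hy, hpar'⟩
    · simp only [pt_apply_zero, pt_apply_one] at hy hpar'; omega
    · simp only [pt_apply_one] at hy; omega

/-- Backward form of `bottom_corner_pred`: if `ω (i₀+1) = (xb−1, L)` (and `ω (i₀−1) = (xb, L+1)`) and `i₀ + 2 ≤ n` (the corner is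
not the site `(2,0)` next to the end `e₀` of the walk) then `ω (i₀+2) = (xb−2, L)`. [cite: EntingJensen2009, §7.4.2, Fig. 7.10 (brickwork form of the honeycomb lattice)] -/
theorem bottom_corner_succ (hω : ω ∈ canonEnd n) {L xb : ℤ} {i₀ : ℕ} (hi₀ : 1 ≤ i₀) (hi₀2 : i₀ + 2 ≤ n)
    (hv : ω i₀ = pt xb L) (hminH : ∀ i, i ≤ n → L ≤ ω i 1)
    (hs : ω (i₀ + 1) = pt (xb - 1) L) (hp : ω (i₀ - 1) = pt xb (L + 1)) :
    ω (i₀ + 2) = pt (xb - 2) L := by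
  obtain ⟨hE, hlex⟩ := mem_canonEnd.1 hω
  obtain ⟨⟨h0, -, hbw, hinj⟩, hn'⟩ := mem_endAt_iff.1 hE
  have hvert := vertical_cases (hbw (i₀ - 1) (by omega)) (by rw [show i₀ - 1 + 1 = i₀ by omega, hv, hp]; simp)
  have hpar : (xb + L) % 2 = 0 := by
    rw [show i₀ - 1 + 1 = i₀ by omega, hv, hp] at hvert; simp only [pt_apply_zero, pt_apply_one] at hvert; omega
  have hadj : brickWallGraph.Adj (ω (i₀ + 1)) (ω (i₀ + 2)) := hbw (i₀ + 1) (by omega)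
  have hne : ω (i₀ + 2) ≠ ω i₀ := by
    intro h
    have := hinj (show i₀ + 2 ∈ {i | i ≤ n} by simp; omega) (show i₀ ∈ {i | i ≤ n} by simp; omega) h
    omega
  have hzL : L ≤ ω (i₀ + 2) 1 := hminH _ (by omega)
  rw [hs] at hadj
  rcases adj_cases hadj with ⟨h1', h2'⟩ | ⟨h1', h2'⟩ | h1'
  · exfalso; apply hne; rw [hv, bt_site_eq_iff]; simp only [pt_apply_zero, pt_apply_one] at h1' h2' ⊢; exact ⟨by omega, by omega⟩
  · rw [bt_site_eq_iff]; simp only [pt_apply_zero, pt_apply_one] at h1' h2' ⊢; exact ⟨by omega, by omega⟩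
  · exfalso
    rcases vertical_cases hadj h1' with ⟨hy, hpar'⟩ | ⟨hy, hpar'⟩
    · simp only [pt_apply_zero, pt_apply_one] at hy hpar'; omega
    · simp only [pt_apply_one] at hy; omega

/-- A site below the bottom row, or on the bottom row right of the bottom corner, is not on `ω`. [cite: MadrasSlade1993, §3.2 (proof of Theorem 3.2.3)] -/
theorem ne_of_low {L xb a b : ℤ} (hminH : ∀ i, i ≤ n → L ≤ ω i 1) (hmaxX : ∀ i, i ≤ n → ω i 1 = L → ω i 0 ≤ xb)
    (h : b < L ∨ (b = L ∧ xb < a)) {i : ℕ} (hi : i ≤ n) : pt a b ≠ ω i := by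
  intro he
  have h1 := hminH i hi; have h2 := hmaxX i hi
  rw [← he] at h1 h2; simp only [pt_apply_zero, pt_apply_one] at h1 h2
  rcases h with h | ⟨hb, ha⟩
  · omega
  · have := h2 hb; omega

/-- **Intrinsic bottom corner of a walk**: `L'` bounds all heights from below, `x'` bounds the abscissae on the bottom row, and the site
`(x', L')` is visited at time `τ`. [cite: MadrasSlade1993, §3.2 (proof of Theorem 3.2.3: an extreme point)] -/
def BotSix (N : ℕ) (W : ℕ → Site 2) (L' x' : ℤ) (τ : ℕ) : Prop :=
  (∀ i, i ≤ N → L' ≤ W i 1) ∧ (∀ i, i ≤ N → W i 1 = L' → W i 0 ≤ x') ∧ τ ≤ N ∧ W τ = pt x' L'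

/-- The intrinsic bottom corner is unique (given injectivity of the walk). [cite: MadrasSlade1993, §3.2 (proof of Theorem 3.2.3)] -/
theorem botAt_unique {N : ℕ} {W : ℕ → Site 2} (hinj : Set.InjOn W {i | i ≤ N}) {L₁ x₁ L₂ x₂ : ℤ} {τ₁ τ₂ : ℕ}
    (h₁ : BotSix N W L₁ x₁ τ₁) (h₂ : BotSix N W L₂ x₂ τ₂) : L₁ = L₂ ∧ x₁ = x₂ ∧ τ₁ = τ₂ := by
  obtain ⟨hH₁, hx₁, hτ₁, hW₁⟩ := h₁
  obtain ⟨hH₂, hx₂, hτ₂, hW₂⟩ := h₂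
  have e1 := hH₂ τ₁ hτ₁; rw [hW₁] at e1; simp only [pt_apply_one] at e1
  have e2 := hH₁ τ₂ hτ₂; rw [hW₂] at e2; simp only [pt_apply_one] at e2
  have hH : L₁ = L₂ := le_antisymm e2 e1
  have e3 := hx₂ τ₁ hτ₁ (by rw [hW₁]; simp [hH]); rw [hW₁] at e3; simp only [pt_apply_zero] at e3
  have e4 := hx₁ τ₂ hτ₂ (by rw [hW₂]; simp [hH]); rw [hW₂] at e4; simp only [pt_apply_zero] at e4
  have hx : x₁ = x₂ := le_antisymm e3 e4
  refine ⟨hH, hx, ?_⟩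
  apply hinj (show τ₁ ∈ {i | i ≤ N} by simpa using hτ₁) (show τ₂ ∈ {i | i ≤ N} by simpa using hτ₂)
  rw [hW₁, hW₂, hH, hx]

/-- **Bottom corner of a `K`-spliced image from its table**: if every table site has height offset `≥ dL` (`dL ≤ 0`), those at offset
`dL` have abscissa offset `≤ dX`, the entry `u₀` is `(dX, dL)`, and — when `dL = 0` — also `dX ≥ 0`, then the image's intrinsic bottom
corner is `(xb + dX, L + dL)` at time `j + rd fwd (Lw+K) u₀`. [cite: MadrasSlade1993, §3.2 (proof of Theorem 3.2.3: an extreme point)] -/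
theorem botAt_spliceAdd {K Lw j : ℕ} {xb L : ℤ} {fwd : Bool} {off : ℕ → ℤ × ℤ}
    (hminH : ∀ i, i ≤ n → L ≤ ω i 1) (hmaxX : ∀ i, i ≤ n → ω i 1 = L → ω i 0 ≤ xb)
    (hP : SpliceAddOK n K Lw ω j (tpath off (Lw + K) xb L fwd))
    {dL dX : ℤ} (hdL : dL ≤ 0) (hdX : dL = 0 → 0 ≤ dX)
    (htab : ∀ u, u ≤ Lw + K → dL ≤ (off u).2 ∧ ((off u).2 = dL → (off u).1 ≤ dX))
    {u₀ : ℕ} (hu₀ : u₀ ≤ Lw + K) (hoff : off u₀ = (dX, dL)) :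
    BotSix (n + K) (spliceAdd K Lw ω (tpath off (Lw + K) xb L fwd) j) (L + dL) (xb + dX) (j + rd fwd (Lw + K) u₀) := by
  refine ⟨fun i hi => ?_, fun i hi hiH => ?_, by have := hP.wnd; have := rd_le (fwd := fwd) hu₀; omega, ?_⟩
  · rcases spliceAdd_site_cases hP hi with ⟨a, ha, -, hia⟩ | ⟨s, hs, his⟩
    · rw [hia]; have := hminH a ha; omega
    · rw [his, tpath, pt_apply_one]; have := (htab _ (rd_le (fwd := fwd) hs)).1; omega
  · rcases spliceAdd_site_cases hP hi with ⟨a, ha, -, hia⟩ | ⟨s, hs, his⟩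
    · rw [hia] at hiH ⊢; have h1 := hminH a ha
      have hdL0 : dL = 0 := by omega
      have := hmaxX a ha (by omega); have := hdX hdL0; omega
    · rw [his, tpath, pt_apply_one] at hiH; rw [his, tpath, pt_apply_zero]
      have := (htab _ (rd_le (fwd := fwd) hs)).2 (by omega); omega
  · rw [spliceAdd_mid hP.start (rd_le hu₀), tpath]
    have : rd fwd (Lw + K) (rd fwd (Lw + K) u₀) = u₀ := by unfold rd; split_ifs <;> omega
    rw [this, hoff]

end BottomCorner

/-! ### The mirrored surgeries at the bottom corner: tables, admissibility, freshness -/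

section BottomMoves

variable {xb L : ℤ} {fwd : Bool} {j k : ℕ}

/-- Case X♭ path (the `+2` flip across the brick `[xb−3,xb−1]×[L−1,L]` below the bottom run): from `(xb−3,L)` down, right twice, up to
`(xb−1,L)` — the table `offX` with its height offsets negated. [cite: MadrasSlade1993, §3.2 (proof of Theorem 3.2.3: local surgery)] -/
def offXb : ℕ → ℤ × ℤ
  | 0 => (-3, 0) | 1 => (-3, -1) | 2 => (-2, -1) | 3 => (-1, -1) | _ => (-1, 0)

/-- Table X♭ is a brick-wall path (given the bottom-corner parity `xb + L` even). [cite: EntingJensen2009, §7.4.2, Fig. 7.10] -/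
theorem offXb_adj (hpar : (xb + L) % 2 = 0) {s : ℕ} (hs : s < 4) :
    brickWallGraph.Adj (pt (xb + (offXb s).1) (L + (offXb s).2)) (pt (xb + (offXb (s + 1)).1) (L + (offXb (s + 1)).2)) := by
  interval_cases s <;> simp only [offXb] <;> exact adj_pt_iff.2 (by omega)

/-- Table X♭ is injective on `[0,4]`. [cite: MadrasSlade1993, §3.2] -/
theorem offXb_inj {s s' : ℕ} (hs : s ≤ 4) (hs' : s' ≤ 4)
    (h : pt (xb + (offXb s).1) (L + (offXb s).2) = pt (xb + (offXb s').1) (L + (offXb s').2)) : s = s' := by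
  interval_cases s <;> interval_cases s' <;> simp only [offXb] at h <;>
    first | rfl | (obtain ⟨h1, h2⟩ := pt_inj.1 h; omega)

/-- **Case X♭ surgery is admissible**: for the window `(xb−3,L)(xb−2,L)(xb−1,L)` on `ω` at a bottom corner with `xb ≥ 4` (automatic: the
site `(xb−3, L)` is lexicographically `≥ 0` and `xb + L` is even), the `+2` flip below it satisfies `SpliceAddOK n 2 2` — the new sites lie
below the bottom row and have abscissa `≥ xb − 3 ≥ 1`. [cite: MadrasSlade1993, §3.2 (proof of Theorem 3.2.3: local surgery)] -/
theorem spliceOK_Xb (hpar : (xb + L) % 2 = 0) (hx : 4 ≤ xb)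
    (hminH : ∀ i, i ≤ n → L ≤ ω i 1) (hmaxX : ∀ i, i ≤ n → ω i 1 = L → ω i 0 ≤ xb)
    (hw : ∀ s, s ≤ 2 → ω (j + s) = tpath w6A 2 xb L fwd s) (hwnd : j + 2 ≤ n) :
    SpliceAddOK n 2 2 ω j (tpath offXb 4 xb L fwd) := by
  refine spliceAddOK_of_tables (L := 2) (K := 2) (w := w6A) (by norm_num) (by rfl) (by rfl) (fun s hs => offXb_adj hpar hs)
    (fun s s' hs hs' h => offXb_inj hs hs' h) (fun u hu0 hu1 i hi _ => ?_) (fun u hu => ?_) hw hwnd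
  · interval_cases u <;> simp only [offXb] <;> exact ne_of_low hminH hmaxX (by omega) hi
  · interval_cases u <;> simp only [offXb] <;> exact bt_lexNonneg_pt (by omega)

/-- **The case-X♭ image is a canonical `(n+3)`-gon.** [cite: MadrasSlade1993, §3.2 (proof of Theorem 3.2.3)] -/
theorem spliceXb_mem_canonEnd (hω : ω ∈ canonEnd n) (hpar : (xb + L) % 2 = 0) (hx : 4 ≤ xb)
    (hminH : ∀ i, i ≤ n → L ≤ ω i 1) (hmaxX : ∀ i, i ≤ n → ω i 1 = L → ω i 0 ≤ xb)
    (hw : ∀ s, s ≤ 2 → ω (j + s) = tpath w6A 2 xb L fwd s) (hwnd : j + 2 ≤ n) :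
    spliceAdd 2 2 ω (tpath offXb 4 xb L fwd) j ∈ canonEnd (n + 2) :=
  spliceAdd_mem_canonEnd hω (spliceOK_Xb hpar hx hminH hmaxX hw hwnd)

/-- Window table of the floor move `Y⋆♭_k`: `(0,0)`, then the run `(s−1, +1)`, `1 ≤ s ≤ 2k`, along the row `L+1` (the table `wYs`
with its height offsets negated). [cite: MadrasSlade1993, §3.2 (proof of Theorem 3.2.3: local surgery)] -/
def wYsb (s : ℕ) : ℤ × ℤ := if s = 0 then (0, 0) else ((s : ℤ) - 1, 1)

/-- Replacement table of the floor move `Y⋆♭_k`: the floor `(s, 0)`, `0 ≤ s ≤ 2k`, under the run, then up to `(2k, 1)` and left to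
`(2k−1, 1)`. [cite: MadrasSlade1993, §3.2 (proof of Theorem 3.2.3: local surgery)] -/
def offYsb (k : ℕ) (s : ℕ) : ℤ × ℤ :=
  if s ≤ 2 * k then ((s : ℤ), 0) else if s = 2 * k + 1 then (2 * (k : ℤ), 1) else (2 * (k : ℤ) - 1, 1)

/-- The floor table is a brick-wall path (given `xb + L` even: the bond `(xb+2k,L) – (xb+2k,L+1)` is vertical at an even lower site).
[cite: EntingJensen2009, §7.4.2, Fig. 7.10 (brickwork form of the honeycomb lattice)] -/
theorem offYsb_adj (hpar : (xb + L) % 2 = 0) {s : ℕ} (hs : s < 2 * k + 2) :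
    brickWallGraph.Adj (pt (xb + (offYsb k s).1) (L + (offYsb k s).2)) (pt (xb + (offYsb k (s + 1)).1) (L + (offYsb k (s + 1)).2)) := by
  unfold offYsb
  rcases Nat.lt_or_ge (s + 1) (2 * k + 1) with h1 | h1
  · rw [if_pos (by omega), if_pos (by omega)]; push_cast; exact adj_pt_iff.2 (by omega)
  rcases Nat.lt_or_ge s (2 * k + 1) with h2 | h2
  · have hs' : s = 2 * k := by omega
    subst hs'
    rw [if_pos le_rfl, if_neg (by omega), if_pos rfl]; push_cast; exact adj_pt_iff.2 (by omega)
  · have hs' : s = 2 * k + 1 := by omega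
    subst hs'
    rw [if_neg (by omega), if_pos rfl, if_neg (by omega), if_neg (by omega)]; exact adj_pt_iff.2 (by omega)

/-- The floor table is injective on `[0, 2k+2]`. [cite: MadrasSlade1993, §3.2] -/
theorem offYsb_inj {s s' : ℕ} (hs : s ≤ 2 * k + 2) (hs' : s' ≤ 2 * k + 2)
    (h : pt (xb + (offYsb k s).1) (L + (offYsb k s).2) = pt (xb + (offYsb k s').1) (L + (offYsb k s').2)) : s = s' := by
  obtain ⟨h1, h2⟩ := pt_inj.1 h
  unfold offYsb at h1 h2
  split_ifs at h1 h2 <;> push_cast at h1 h2 <;> omega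

/-- The window table at offset `s ≥ 1` reads the run site `(xb+s−1, L+1)`. [cite: MadrasSlade1993, §3.2] -/
theorem wYsb_pos {s : ℕ} (hs : 1 ≤ s) : wYsb s = ((s : ℤ) - 1, 1) := if_neg (by omega)

/-- **The floor surgery is admissible**: for `xb ≥ 1`, the window `(xb,L)(xb,L+1)(xb+1,L+1)…(xb+2k−1,L+1)` on `ω` (`k ≥ 1`) and
`(xb+2k, L+1)` NOT a site of `ω`, the floor `offYsb k` satisfies `SpliceAddOK n 2 (2k)`: its interior sites are on the bottom row right of
the corner or the one site `(xb+2k, L+1)`. [cite: MadrasSlade1993, §3.2 (proof of Theorem 3.2.3: local surgery)] -/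
theorem spliceOK_Ysb (hpar : (xb + L) % 2 = 0) (hx : 1 ≤ xb) (hk : 1 ≤ k)
    (hminH : ∀ i, i ≤ n → L ≤ ω i 1) (hmaxX : ∀ i, i ≤ n → ω i 1 = L → ω i 0 ≤ xb)
    (hE : ∀ i, i ≤ n → ω i ≠ pt (xb + 2 * k) (L + 1))
    (hw : ∀ s, s ≤ 2 * k → ω (j + s) = tpath wYsb (2 * k) xb L fwd s) (hwnd : j + 2 * k ≤ n) :
    SpliceAddOK n 2 (2 * k) ω j (tpath (offYsb k) (2 * k + 2) xb L fwd) := by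
  refine spliceAddOK_of_tables (L := 2 * k) (K := 2) (w := wYsb) (by omega) ?_ ?_ (fun s hs => offYsb_adj hpar hs)
    (fun s s' hs hs' h => offYsb_inj hs hs' h) (fun u hu0 hu1 i hi _ => ?_) (fun u hu => ?_) hw hwnd
  · simp [offYsb, wYsb]
  · rw [wYsb_pos (by omega)]; unfold offYsb; rw [if_neg (by omega), if_neg (by omega)]; push_cast; ring_nf
  · unfold offYsb
    by_cases h1 : u ≤ 2 * k
    · rw [if_pos h1]; push_cast; exact ne_of_low hminH hmaxX (by omega) hi
    · rw [if_neg h1, if_pos (by omega)]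
      exact fun h => hE i hi h.symm
  · unfold offYsb; split_ifs <;> push_cast <;> exact bt_lexNonneg_pt (by omega)

/-- **The floor image is a canonical `(n+3)`-gon.** [cite: MadrasSlade1993, §3.2 (proof of Theorem 3.2.3)] -/
theorem spliceYsb_mem_canonEnd (hω : ω ∈ canonEnd n) (hpar : (xb + L) % 2 = 0) (hx : 1 ≤ xb) (hk : 1 ≤ k)
    (hminH : ∀ i, i ≤ n → L ≤ ω i 1) (hmaxX : ∀ i, i ≤ n → ω i 1 = L → ω i 0 ≤ xb)
    (hE : ∀ i, i ≤ n → ω i ≠ pt (xb + 2 * k) (L + 1))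
    (hw : ∀ s, s ≤ 2 * k → ω (j + s) = tpath wYsb (2 * k) xb L fwd s) (hwnd : j + 2 * k ≤ n) :
    spliceAdd 2 (2 * k) ω (tpath (offYsb k) (2 * k + 2) xb L fwd) j ∈ canonEnd (n + 2) :=
  spliceAdd_mem_canonEnd hω (spliceOK_Ysb hpar hx hk hminH hmaxX hE hw hwnd)

/-- **Freshness of `(xb+2k, L+1)` for the floor move**: if the last run site `(xb+2k−1, L+1) = ω a` has walk-neighbours `(xb+2k−2, L+1)`
and `(xb+2k−1, L+2)` (arrival along the run, then up), then `(xb+2k, L+1)` is not a site of `ω`: its only possible walk-neighbours are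
`(xb+2k±1, L+1)` (down is `(xb+2k, L)`, right of the bottom corner; up is not a brick-wall bond at this odd site), so it would be adjacent on
the walk to `ω a`, whose neighbours are spoken for. [cite: EntingJensen2009, §7.4.2, Fig. 7.10 (brickwork form of the honeycomb lattice)] -/
theorem caseYb_free (hω : ω ∈ endAt n (Pi.single 0 1 : Site 2)) (hpar : (xb + L) % 2 = 0) (hx : 1 ≤ xb) (hk : 1 ≤ k)
    (hminH : ∀ i, i ≤ n → L ≤ ω i 1) (hmaxX : ∀ i, i ≤ n → ω i 1 = L → ω i 0 ≤ xb)
    {a : ℕ} (ha1 : 1 ≤ a) (han : a + 1 ≤ n) (ha : ω a = pt (xb + 2 * k - 1) (L + 1))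
    (hnb : (ω (a - 1) = pt (xb + 2 * k - 2) (L + 1) ∧ ω (a + 1) = pt (xb + 2 * k - 1) (L + 2)) ∨
      (ω (a + 1) = pt (xb + 2 * k - 2) (L + 1) ∧ ω (a - 1) = pt (xb + 2 * k - 1) (L + 2))) :
    ∀ t, t ≤ n → ω t ≠ pt (xb + 2 * k) (L + 1) := by
  obtain ⟨⟨h0, -, hbw, hinj⟩, hn'⟩ := mem_endAt_iff.1 hω
  intro t ht hωt
  -- the walk-neighbours of `ω t` are `(xb+2k−1,L+1)` or `(xb+2k+1,L+1)`
  have key : ∀ z : Site 2, brickWallGraph.Adj (ω t) z → (∃ i, i ≤ n ∧ ω i = z) →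
      z = pt (xb + 2 * k - 1) (L + 1) ∨ z = pt (xb + 2 * k + 1) (L + 1) := by
    intro z hadj ⟨i, hi, hiz⟩
    have hzL : L ≤ z 1 := by rw [← hiz]; exact hminH i hi
    have hzX : z 1 = L → z 0 ≤ xb := by rw [← hiz]; exact hmaxX i hi
    rw [hωt] at hadj
    rcases adj_cases hadj with ⟨hz0, hz1⟩ | ⟨hz0, hz1⟩ | hz0
    · right; rw [bt_site_eq_iff]; simp only [pt_apply_zero, pt_apply_one] at hz0 hz1 ⊢; omega
    · left; rw [bt_site_eq_iff]; simp only [pt_apply_zero, pt_apply_one] at hz0 hz1 ⊢; omega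
    · exfalso
      rcases vertical_cases hadj hz0 with ⟨hy, hp⟩ | ⟨hy, hp⟩
      · simp only [pt_apply_zero, pt_apply_one] at hy hp hz0; omega
      · simp only [pt_apply_zero, pt_apply_one] at hy hz0; have := hzX (by omega); omega
  -- `t ≠ 0, n`: both walk-neighbours exist as genuine neighbours
  -- `t ≠ 0, n`: the sites `(0,0)`, `(1,0)` have abscissa `< xb + 2k`
  have ht0 : t ≠ 0 := by
    rintro rfl; rw [h0] at hωt; have h1 := congrFun hωt 0; simp at h1; omega
  have htn : t ≠ n := by
    rintro rfl; rw [hn'] at hωt; have h1 := congrFun hωt 0; simp at h1; omega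
  have hp := key _ (by have := hbw (t - 1) (by omega); rw [show t - 1 + 1 = t by omega] at this; exact this.symm) ⟨t - 1, by omega, rfl⟩
  have hs := key _ (hbw t (by omega)) ⟨t + 1, by omega, rfl⟩
  have hne : ω (t - 1) ≠ ω (t + 1) := by
    intro h; have := hinj (show t - 1 ∈ {i | i ≤ n} by simp; omega) (show t + 1 ∈ {i | i ≤ n} by simp; omega) h; omega
  have hta : t - 1 = a ∨ t + 1 = a := by
    rcases hp with hp | hp
    · left; rw [← ha] at hp; exact hinj (show t - 1 ∈ {i | i ≤ n} by simp; omega) (show a ∈ {i | i ≤ n} by simp; omega) hp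
    · rcases hs with hs | hs
      · right; rw [← ha] at hs; exact hinj (show t + 1 ∈ {i | i ≤ n} by simp; omega) (show a ∈ {i | i ≤ n} by simp; omega) hs
      · exact absurd (hp.trans hs.symm) hne
  rcases hta with hta | hta
  · have : t = a + 1 := by omega
    subst this
    rcases hnb with ⟨-, h⟩ | ⟨h, -⟩ <;> · rw [h] at hωt; have := pt_inj.1 hωt; omega
  · have : t = a - 1 := by omega
    subst this
    rcases hnb with ⟨h, -⟩ | ⟨-, h⟩ <;> · rw [h] at hωt; have := pt_inj.1 hωt; omega


/-! ### The run above the bottom corner always ends with a step up -/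

/-- **One step along the floor run, forward.** On the row `L+1`, right of the corner abscissa, the walk arriving from the left at
`(xb+s−1, L+1)` (time `i₀+s`, `s ≥ 2`) continues RIGHT to `(xb+s, L+1)`, or — only when `s` is even (the sites carrying an upward bond) —
UP to `(xb+s−1, L+2)`; at odd `s` the vertical bond goes DOWN to `(xb+s−1, L)`, right of the bottom corner, which is not on `ω`.
[cite: EntingJensen2009, §7.4.2, Fig. 7.10 (brickwork form of the honeycomb lattice)] -/
theorem floor_run_step_fwd {i₀ s : ℕ} (hω : ω ∈ endAt n (Pi.single 0 1 : Site 2)) (hpar : (xb + L) % 2 = 0)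
    (hx : 2 ≤ xb) (hmaxX : ∀ i, i ≤ n → ω i 1 = L → ω i 0 ≤ xb) (hs : 2 ≤ s) (hsn : i₀ + s ≤ n)
    (hprev : ω (i₀ + (s - 1)) = pt (xb + (s - 1 : ℕ) - 1) (L + 1)) (hcur : ω (i₀ + s) = pt (xb + s - 1) (L + 1)) :
    i₀ + s + 1 ≤ n ∧ (ω (i₀ + s + 1) = pt (xb + s) (L + 1) ∨ (s % 2 = 0 ∧ ω (i₀ + s + 1) = pt (xb + s - 1) (L + 2))) := by
  obtain ⟨⟨h0, -, hbw, hinj⟩, hn'⟩ := mem_endAt_iff.1 hω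
  have hne : i₀ + s ≠ n := by
    intro h; rw [h, hn'] at hcur; have := congrFun hcur 0; simp at this; omega
  refine ⟨by omega, ?_⟩
  have hadj : brickWallGraph.Adj (ω (i₀ + s)) (ω (i₀ + s + 1)) := hbw (i₀ + s) (by omega)
  rw [hcur] at hadj
  have hback : ω (i₀ + s + 1) ≠ ω (i₀ + (s - 1)) := by
    intro h
    have := hinj (show i₀ + s + 1 ∈ {i | i ≤ n} by simp; omega) (show i₀ + (s - 1) ∈ {i | i ≤ n} by simp; omega) h; omega
  have hX := hmaxX (i₀ + s + 1) (by omega)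
  rcases adj_cases hadj with ⟨hz0, hz1⟩ | ⟨hz0, hz1⟩ | hz0
  · left; rw [bt_site_eq_iff]; simp only [pt_apply_zero, pt_apply_one] at hz0 hz1 ⊢; omega
  · exfalso; apply hback; rw [hprev, bt_site_eq_iff]; simp only [pt_apply_zero, pt_apply_one] at hz0 hz1 ⊢; omega
  · rcases vertical_cases hadj hz0 with ⟨hy, hp⟩ | ⟨hy, hp⟩
    · right; simp only [pt_apply_zero, pt_apply_one] at hz0 hy hp
      refine ⟨by omega, ?_⟩
      rw [bt_site_eq_iff]; simp only [pt_apply_zero, pt_apply_one]; omega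
    · -- down: `(xb+s−1, L)` is right of the bottom corner
      exfalso; simp only [pt_apply_zero, pt_apply_one] at hz0 hy; have := hX (by omega); omega

/-- **One step along the floor run, backward** (times decreasing). [cite: EntingJensen2009, §7.4.2, Fig. 7.10 (brickwork form of the honeycomb lattice)] -/
theorem floor_run_step_bwd {i₀ s : ℕ} (hω : ω ∈ endAt n (Pi.single 0 1 : Site 2)) (hpar : (xb + L) % 2 = 0)
    (hx : 2 ≤ xb) (hmaxX : ∀ i, i ≤ n → ω i 1 = L → ω i 0 ≤ xb) (hs : 2 ≤ s) (hsi : s ≤ i₀) (hi₀n : i₀ ≤ n)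
    (hprev : ω (i₀ - (s - 1)) = pt (xb + (s - 1 : ℕ) - 1) (L + 1)) (hcur : ω (i₀ - s) = pt (xb + s - 1) (L + 1)) :
    s + 1 ≤ i₀ ∧ (ω (i₀ - (s + 1)) = pt (xb + s) (L + 1) ∨ (s % 2 = 0 ∧ ω (i₀ - (s + 1)) = pt (xb + s - 1) (L + 2))) := by
  obtain ⟨⟨h0, -, hbw, hinj⟩, hn'⟩ := mem_endAt_iff.1 hω
  have hne : i₀ - s ≠ 0 := by
    intro h; rw [h, h0] at hcur; have := congrFun hcur 0; simp at this; omega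
  refine ⟨by omega, ?_⟩
  have hadj : brickWallGraph.Adj (ω (i₀ - s)) (ω (i₀ - (s + 1))) := by
    have := hbw (i₀ - (s + 1)) (by omega); rw [show i₀ - (s + 1) + 1 = i₀ - s by omega] at this; exact this.symm
  rw [hcur] at hadj
  have hback : ω (i₀ - (s + 1)) ≠ ω (i₀ - (s - 1)) := by
    intro h
    have := hinj (show i₀ - (s + 1) ∈ {i | i ≤ n} by simp; omega) (show i₀ - (s - 1) ∈ {i | i ≤ n} by simp; omega) h; omega
  have hX := hmaxX (i₀ - (s + 1)) (by omega)
  rcases adj_cases hadj with ⟨hz0, hz1⟩ | ⟨hz0, hz1⟩ | hz0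
  · left; rw [bt_site_eq_iff]; simp only [pt_apply_zero, pt_apply_one] at hz0 hz1 ⊢; omega
  · exfalso; apply hback; rw [hprev, bt_site_eq_iff]; simp only [pt_apply_zero, pt_apply_one] at hz0 hz1 ⊢; omega
  · rcases vertical_cases hadj hz0 with ⟨hy, hp⟩ | ⟨hy, hp⟩
    · right; simp only [pt_apply_zero, pt_apply_one] at hz0 hy hp
      refine ⟨by omega, ?_⟩
      rw [bt_site_eq_iff]; simp only [pt_apply_zero, pt_apply_one]; omega
    · exfalso; simp only [pt_apply_zero, pt_apply_one] at hz0 hy; have := hX (by omega); omega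

/-- **The floor run ends with a step up, forward**: if above the bottom corner the walk steps up then right
(`ω (i₀+1) = (xb,L+1)`, `ω (i₀+2) = (xb+1,L+1)`), then for some `k ≥ 1` it runs `ω (i₀+s) = (xb+s−1,L+1)` for `1 ≤ s ≤ 2k` and steps up
next: `ω (i₀+2k+1) = (xb+2k−1,L+2)`. [cite: MadrasSlade1993, §3.2 (proof of Theorem 3.2.3: the local structure at an extreme point)] -/
theorem exists_floor_run_fwd {i₀ : ℕ} (hω : ω ∈ endAt n (Pi.single 0 1 : Site 2)) (hpar : (xb + L) % 2 = 0)
    (hx : 2 ≤ xb) (hmaxX : ∀ i, i ≤ n → ω i 1 = L → ω i 0 ≤ xb) (hi₀n : i₀ + 2 ≤ n)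
    (h1 : ω (i₀ + 1) = pt xb (L + 1)) (h2 : ω (i₀ + 2) = pt (xb + 1) (L + 1)) :
    ∃ k, 1 ≤ k ∧ i₀ + 2 * k + 1 ≤ n ∧ (∀ s, 1 ≤ s → s ≤ 2 * k → ω (i₀ + s) = pt (xb + s - 1) (L + 1)) ∧
      ω (i₀ + 2 * k + 1) = pt (xb + 2 * k - 1) (L + 2) := by
  suffices aux : ∀ d t, 1 ≤ t → i₀ + 2 * t ≤ n → n - (i₀ + 2 * t) ≤ d →
      (∀ s, 1 ≤ s → s ≤ 2 * t → ω (i₀ + s) = pt (xb + s - 1) (L + 1)) →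
      ∃ k, 1 ≤ k ∧ i₀ + 2 * k + 1 ≤ n ∧ (∀ s, 1 ≤ s → s ≤ 2 * k → ω (i₀ + s) = pt (xb + s - 1) (L + 1)) ∧
        ω (i₀ + 2 * k + 1) = pt (xb + 2 * k - 1) (L + 2) by
    refine aux n 1 le_rfl (by omega) (by omega) fun s hs1 hs2 => ?_
    interval_cases s
    · rw [h1]; congr 1; ring
    · rw [h2]; congr 1; ring
  intro d
  induction d with
  | zero =>
    intro t ht htn hd hrun
    obtain ⟨⟨h0, -, hbw, hinj⟩, hn'⟩ := mem_endAt_iff.1 hω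
    exfalso
    have h := hrun (2 * t) (by omega) le_rfl
    rw [show i₀ + 2 * t = n by omega, hn'] at h
    have := congrFun h 0; simp at this; omega
  | succ d ih =>
    intro t ht htn hd hrun
    have hprev : ω (i₀ + (2 * t - 1)) = pt (xb + (2 * t - 1 : ℕ) - 1) (L + 1) := hrun (2 * t - 1) (by omega) (by omega)
    have hcur : ω (i₀ + 2 * t) = pt (xb + (2 * t : ℕ) - 1) (L + 1) := hrun (2 * t) (by omega) le_rfl
    obtain ⟨hn1, hstep⟩ := floor_run_step_fwd hω hpar hx hmaxX (s := 2 * t) (by omega) htn hprev hcur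
    rcases hstep with hR | ⟨-, hD⟩
    · have hprev' : ω (i₀ + (2 * t + 1 - 1)) = pt (xb + (2 * t + 1 - 1 : ℕ) - 1) (L + 1) := by
        rw [show 2 * t + 1 - 1 = 2 * t by omega, hcur]
      have hcur' : ω (i₀ + (2 * t + 1)) = pt (xb + (2 * t + 1 : ℕ) - 1) (L + 1) := by
        rw [← add_assoc, hR]; congr 1; push_cast; ring
      obtain ⟨hn2, hstep2⟩ := floor_run_step_fwd hω hpar hx hmaxX (s := 2 * t + 1) (by omega) hn1 hprev' hcur'
      rcases hstep2 with hRR | ⟨hodd, -⟩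
      · refine ih (t + 1) (by omega) (by omega) (by omega) fun s hs1 hs2 => ?_
        rcases Nat.lt_or_ge s (2 * t + 1) with h3 | h3
        · exact hrun s hs1 (by omega)
        rcases Nat.lt_or_ge s (2 * t + 2) with h4 | h4
        · obtain rfl : s = 2 * t + 1 := by omega
          exact hcur'
        · obtain rfl : s = 2 * t + 2 := by omega
          rw [show i₀ + (2 * t + 2) = i₀ + (2 * t + 1) + 1 by omega, hRR]; congr 1; push_cast; ring
      · omega
    · exact ⟨t, ht, hn1, hrun, by exact_mod_cast hD⟩

/-- **The floor run ends with a step up, backward** (`ω (i₀−1) = (xb,L+1)`, `ω (i₀−2) = (xb+1,L+1)`).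
[cite: MadrasSlade1993, §3.2 (proof of Theorem 3.2.3: the local structure at an extreme point)] -/
theorem exists_floor_run_bwd {i₀ : ℕ} (hω : ω ∈ endAt n (Pi.single 0 1 : Site 2)) (hpar : (xb + L) % 2 = 0)
    (hx : 2 ≤ xb) (hmaxX : ∀ i, i ≤ n → ω i 1 = L → ω i 0 ≤ xb) (hi₀ : 2 ≤ i₀) (hi₀n : i₀ ≤ n)
    (h1 : ω (i₀ - 1) = pt xb (L + 1)) (h2 : ω (i₀ - 2) = pt (xb + 1) (L + 1)) :
    ∃ k, 1 ≤ k ∧ 2 * k + 1 ≤ i₀ ∧ (∀ s, 1 ≤ s → s ≤ 2 * k → ω (i₀ - s) = pt (xb + s - 1) (L + 1)) ∧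
      ω (i₀ - (2 * k + 1)) = pt (xb + 2 * k - 1) (L + 2) := by
  suffices aux : ∀ d t, 1 ≤ t → 2 * t ≤ i₀ → i₀ - 2 * t ≤ d →
      (∀ s, 1 ≤ s → s ≤ 2 * t → ω (i₀ - s) = pt (xb + s - 1) (L + 1)) →
      ∃ k, 1 ≤ k ∧ 2 * k + 1 ≤ i₀ ∧ (∀ s, 1 ≤ s → s ≤ 2 * k → ω (i₀ - s) = pt (xb + s - 1) (L + 1)) ∧
        ω (i₀ - (2 * k + 1)) = pt (xb + 2 * k - 1) (L + 2) by
    refine aux i₀ 1 le_rfl (by omega) (by omega) fun s hs1 hs2 => ?_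
    interval_cases s
    · rw [h1]; congr 1; ring
    · rw [h2]; congr 1; ring
  intro d
  induction d with
  | zero =>
    intro t ht hti hd hrun
    obtain ⟨⟨h0, -, hbw, hinj⟩, hn'⟩ := mem_endAt_iff.1 hω
    exfalso
    have h := hrun (2 * t) (by omega) le_rfl
    rw [show i₀ - 2 * t = 0 by omega, h0] at h
    have := congrFun h 0; simp at this; omega
  | succ d ih =>
    intro t ht hti hd hrun
    have hprev : ω (i₀ - (2 * t - 1)) = pt (xb + (2 * t - 1 : ℕ) - 1) (L + 1) := hrun (2 * t - 1) (by omega) (by omega)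
    have hcur : ω (i₀ - 2 * t) = pt (xb + (2 * t : ℕ) - 1) (L + 1) := hrun (2 * t) (by omega) le_rfl
    obtain ⟨hn1, hstep⟩ := floor_run_step_bwd hω hpar hx hmaxX (s := 2 * t) (by omega) hti hi₀n hprev hcur
    rcases hstep with hR | ⟨-, hD⟩
    · have hprev' : ω (i₀ - (2 * t + 1 - 1)) = pt (xb + (2 * t + 1 - 1 : ℕ) - 1) (L + 1) := by
        rw [show 2 * t + 1 - 1 = 2 * t by omega, hcur]
      have hcur' : ω (i₀ - (2 * t + 1)) = pt (xb + (2 * t + 1 : ℕ) - 1) (L + 1) := by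
        rw [hR]; congr 1; push_cast; ring
      obtain ⟨hn2, hstep2⟩ := floor_run_step_bwd hω hpar hx hmaxX (s := 2 * t + 1) (by omega) hn1 hi₀n hprev' hcur'
      rcases hstep2 with hRR | ⟨hodd, -⟩
      · refine ih (t + 1) (by omega) (by omega) (by omega) fun s hs1 hs2 => ?_
        rcases Nat.lt_or_ge s (2 * t + 1) with h3 | h3
        · exact hrun s hs1 (by omega)
        rcases Nat.lt_or_ge s (2 * t + 2) with h4 | h4
        · obtain rfl : s = 2 * t + 1 := by omega
          exact hcur'
        · obtain rfl : s = 2 * t + 2 := by omega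
          rw [show 2 * t + 2 = 2 * t + 1 + 1 by omega, hRR]; congr 1; push_cast; ring
      · omega
    · exact ⟨t, ht, hn1, hrun, by exact_mod_cast hD⟩

/-! ### The first step above the corner, class X♭ detection, and the sites beyond the corner -/

/-- **Above the bottom corner, forward, first step**: after `ω i₀ = (xb,L)`, `ω (i₀+1) = (xb,L+1)` the walk continues horizontally,
`ω (i₀+2) = (xb−1,L+1)` or `(xb+1,L+1)` (down is `ω i₀`, up is not a brick-wall bond at this odd site).
[cite: EntingJensen2009, §7.4.2, Fig. 7.10 (brickwork form of the honeycomb lattice)] -/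
theorem caseYb_step1_fwd {i₀ : ℕ} (hω : ω ∈ endAt n (Pi.single 0 1 : Site 2)) (hpar : (xb + L) % 2 = 0) (hx : 2 ≤ xb)
    (hi₀n : i₀ + 1 ≤ n) (hv : ω i₀ = pt xb L) (hs : ω (i₀ + 1) = pt xb (L + 1)) :
    i₀ + 2 ≤ n ∧ (ω (i₀ + 2) = pt (xb - 1) (L + 1) ∨ ω (i₀ + 2) = pt (xb + 1) (L + 1)) := by
  obtain ⟨⟨h0, -, hbw, hinj⟩, hn'⟩ := mem_endAt_iff.1 hω
  have hne : i₀ + 1 ≠ n := by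
    intro h; rw [h, hn'] at hs; have := congrFun hs 0; simp at this; omega
  refine ⟨by omega, ?_⟩
  have hadj : brickWallGraph.Adj (ω (i₀ + 1)) (ω (i₀ + 2)) := hbw (i₀ + 1) (by omega)
  rw [hs] at hadj
  have hback : ω (i₀ + 2) ≠ ω i₀ := by
    intro h; have := hinj (show i₀ + 2 ∈ {i | i ≤ n} by simp; omega) (show i₀ ∈ {i | i ≤ n} by simp; omega) h; omega
  rcases adj_cases hadj with ⟨hz0, hz1⟩ | ⟨hz0, hz1⟩ | hz0
  · right; rw [bt_site_eq_iff]; simp only [pt_apply_zero, pt_apply_one] at hz0 hz1 ⊢; omega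
  · left; rw [bt_site_eq_iff]; simp only [pt_apply_zero, pt_apply_one] at hz0 hz1 ⊢; omega
  · exfalso
    rcases vertical_cases hadj hz0 with ⟨hy, hp⟩ | ⟨hy, hp⟩
    · simp only [pt_apply_zero, pt_apply_one] at hz0 hy hp; omega
    · apply hback; rw [hv, bt_site_eq_iff]; simp only [pt_apply_zero, pt_apply_one] at hz0 hy ⊢; omega

/-- Backward form of `caseYb_step1_fwd`: with `ω (i₀−1) = (xb,L+1)`, `ω (i₀−2)` is `(xb−1,L+1)` or `(xb+1,L+1)` (and `2 ≤ i₀`).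
[cite: EntingJensen2009, §7.4.2, Fig. 7.10 (brickwork form of the honeycomb lattice)] -/
theorem caseYb_step1_bwd {i₀ : ℕ} (hω : ω ∈ endAt n (Pi.single 0 1 : Site 2)) (hpar : (xb + L) % 2 = 0) (hx : 2 ≤ xb)
    (hi₀ : 1 ≤ i₀) (hi₀n : i₀ ≤ n) (hv : ω i₀ = pt xb L) (hs : ω (i₀ - 1) = pt xb (L + 1)) :
    2 ≤ i₀ ∧ (ω (i₀ - 2) = pt (xb - 1) (L + 1) ∨ ω (i₀ - 2) = pt (xb + 1) (L + 1)) := by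
  obtain ⟨⟨h0, -, hbw, hinj⟩, hn'⟩ := mem_endAt_iff.1 hω
  have hne : i₀ - 1 ≠ 0 := by
    intro h; rw [h, h0] at hs; have := congrFun hs 0; simp at this; omega
  refine ⟨by omega, ?_⟩
  have hadj : brickWallGraph.Adj (ω (i₀ - 1)) (ω (i₀ - 2)) := by
    have := hbw (i₀ - 2) (by omega); rw [show i₀ - 2 + 1 = i₀ - 1 by omega] at this; exact this.symm
  rw [hs] at hadj
  have hback : ω (i₀ - 2) ≠ ω i₀ := by
    intro h; have := hinj (show i₀ - 2 ∈ {i | i ≤ n} by simp; omega) (show i₀ ∈ {i | i ≤ n} by simp; omega) h; omega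
  rcases adj_cases hadj with ⟨hz0, hz1⟩ | ⟨hz0, hz1⟩ | hz0
  · right; rw [bt_site_eq_iff]; simp only [pt_apply_zero, pt_apply_one] at hz0 hz1 ⊢; omega
  · left; rw [bt_site_eq_iff]; simp only [pt_apply_zero, pt_apply_one] at hz0 hz1 ⊢; omega
  · exfalso
    rcases vertical_cases hadj hz0 with ⟨hy, hp⟩ | ⟨hy, hp⟩
    · simp only [pt_apply_zero, pt_apply_one] at hz0 hy hp; omega
    · apply hback; rw [hv, bt_site_eq_iff]; simp only [pt_apply_zero, pt_apply_one] at hz0 hy ⊢; omega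

/-- **Class X♭, forward**: at a bottom corner, if `(xb−3, L)` is a site of `ω` then it is `ω (i₀−3)` (the bottom run continues to the
left): its only possible walk-neighbours are `(xb−4, L)` and `(xb−2, L) = ω (i₀−2)` (down is too low, up is not a brick-wall bond).  The site
`(xb−3, L)` is not the root (parity) and not the end `e₀` of the walk (its predecessor would be `(0,0) = ω 0` or `(2,0) = ω (i₀−2)`).
[cite: EntingJensen2009, §7.4.2, Fig. 7.10 (brickwork form of the honeycomb lattice)] -/
theorem caseAb_fwd {i₀ : ℕ} (hω : ω ∈ endAt n (Pi.single 0 1 : Site 2)) (hpar : (xb + L) % 2 = 0)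
    (hminH : ∀ i, i ≤ n → L ≤ ω i 1) (hi₀ : 2 ≤ i₀) (hi₀n : i₀ + 1 ≤ n)
    (h2 : ω (i₀ - 2) = pt (xb - 2) L) (h1 : ω (i₀ - 1) = pt (xb - 1) L)
    {t : ℕ} (ht : t ≤ n) (hωt : ω t = pt (xb - 3) L) : 3 ≤ i₀ ∧ ω (i₀ - 3) = pt (xb - 3) L := by
  obtain ⟨⟨h0, -, hbw, hinj⟩, hn'⟩ := mem_endAt_iff.1 hω
  have ht0 : t ≠ 0 := by
    rintro rfl; rw [h0] at hωt; have e0 := congrFun hωt 0; have e1 := congrFun hωt 1; simp at e0 e1; omega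
  have key : ∀ z : Site 2, brickWallGraph.Adj (ω t) z → (∃ i, i ≤ n ∧ ω i = z) →
      z = pt (xb - 4) L ∨ z = pt (xb - 2) L := by
    intro z hadj ⟨i, hi, hiz⟩
    have hzL : L ≤ z 1 := by rw [← hiz]; exact hminH i hi
    rw [hωt] at hadj
    rcases adj_cases hadj with ⟨hz0, hz1⟩ | ⟨hz0, hz1⟩ | hz0
    · right; rw [bt_site_eq_iff]; simp only [pt_apply_zero, pt_apply_one] at hz0 hz1 ⊢; omega
    · left; rw [bt_site_eq_iff]; simp only [pt_apply_zero, pt_apply_one] at hz0 hz1 ⊢; omega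
    · exfalso
      rcases vertical_cases hadj hz0 with ⟨hy, hp⟩ | ⟨hy, hp⟩
      · simp only [pt_apply_zero, pt_apply_one] at hy hp; omega
      · simp only [pt_apply_one] at hy; omega
  have hp := key _ (by have := hbw (t - 1) (by omega); rw [show t - 1 + 1 = t by omega] at this; exact this.symm) ⟨t - 1, by omega, rfl⟩
  -- `t ≠ n`: the predecessor of `ω n = (1,0)` would be `(0,0) = ω 0` (so `n = 1`) or `(2,0) = ω (i₀−2)` (so `i₀ = n + 1`)
  have htn : t ≠ n := by
    intro htn'
    rcases hp with hp | hp
    · have e0 : (xb - 4 : ℤ) = 0 ∧ L = 0 := by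
        rw [htn', hn'] at hωt; have a := congrFun hωt 0; have b := congrFun hωt 1; simp at a b; omega
      have : ω (t - 1) = ω 0 := by rw [hp, h0]; ext j; fin_cases j <;> simp [e0.1, e0.2]
      have := hinj (show t - 1 ∈ {i | i ≤ n} by simp; omega) (show 0 ∈ {i | i ≤ n} by simp) this; omega
    · rw [← h2] at hp
      have := hinj (show t - 1 ∈ {i | i ≤ n} by simp; omega) (show i₀ - 2 ∈ {i | i ≤ n} by simp; omega) hp; omega
  have hs := key _ (hbw t (by omega)) ⟨t + 1, by omega, rfl⟩
  have hne : ω (t - 1) ≠ ω (t + 1) := by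
    intro h; have := hinj (show t - 1 ∈ {i | i ≤ n} by simp; omega) (show t + 1 ∈ {i | i ≤ n} by simp; omega) h; omega
  have hx : ω (t - 1) = ω (i₀ - 2) ∨ ω (t + 1) = ω (i₀ - 2) := by
    rw [h2]
    rcases hp with hp | hp <;> rcases hs with hs | hs
    · exact absurd (hp.trans hs.symm) hne
    · exact Or.inr hs
    · exact Or.inl hp
    · exact absurd (hp.trans hs.symm) hne
  rcases hx with hx | hx
  · have := hinj (show t - 1 ∈ {i | i ≤ n} by simp; omega) (show i₀ - 2 ∈ {i | i ≤ n} by simp; omega) hx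
    have ht' : t = i₀ - 1 := by omega
    rw [ht', h1] at hωt; have := (pt_inj.1 hωt).1; omega
  · have := hinj (show t + 1 ∈ {i | i ≤ n} by simp; omega) (show i₀ - 2 ∈ {i | i ≤ n} by simp; omega) hx
    have ht' : t = i₀ - 3 := by omega
    refine ⟨by omega, ?_⟩; rw [← ht']; exact hωt

/-- **Class X♭, backward**: with `ω (i₀+1) = (xb−1,L)`, `ω (i₀+2) = (xb−2,L)`: if `(xb−3, L)` is a site of `ω` then it is
`ω (i₀+3)` (and `i₀ + 3 ≤ n`; when `(xb−3, L)` is the end `e₀` of the walk this is `i₀ + 3 = n`).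
[cite: EntingJensen2009, §7.4.2, Fig. 7.10 (brickwork form of the honeycomb lattice)] -/
theorem caseAb_bwd {i₀ : ℕ} (hω : ω ∈ endAt n (Pi.single 0 1 : Site 2)) (hpar : (xb + L) % 2 = 0)
    (hminH : ∀ i, i ≤ n → L ≤ ω i 1) (hi₀n : i₀ + 2 ≤ n)
    (h2 : ω (i₀ + 2) = pt (xb - 2) L) (h1 : ω (i₀ + 1) = pt (xb - 1) L)
    {t : ℕ} (ht : t ≤ n) (hωt : ω t = pt (xb - 3) L) : i₀ + 3 ≤ n ∧ ω (i₀ + 3) = pt (xb - 3) L := by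
  obtain ⟨⟨h0, -, hbw, hinj⟩, hn'⟩ := mem_endAt_iff.1 hω
  have ht0 : t ≠ 0 := by
    rintro rfl; rw [h0] at hωt; have e0 := congrFun hωt 0; have e1 := congrFun hωt 1; simp at e0 e1; omega
  have key : ∀ z : Site 2, brickWallGraph.Adj (ω t) z → (∃ i, i ≤ n ∧ ω i = z) →
      z = pt (xb - 4) L ∨ z = pt (xb - 2) L := by
    intro z hadj ⟨i, hi, hiz⟩
    have hzL : L ≤ z 1 := by rw [← hiz]; exact hminH i hi
    rw [hωt] at hadj
    rcases adj_cases hadj with ⟨hz0, hz1⟩ | ⟨hz0, hz1⟩ | hz0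
    · right; rw [bt_site_eq_iff]; simp only [pt_apply_zero, pt_apply_one] at hz0 hz1 ⊢; omega
    · left; rw [bt_site_eq_iff]; simp only [pt_apply_zero, pt_apply_one] at hz0 hz1 ⊢; omega
    · exfalso
      rcases vertical_cases hadj hz0 with ⟨hy, hp⟩ | ⟨hy, hp⟩
      · simp only [pt_apply_zero, pt_apply_one] at hy hp; omega
      · simp only [pt_apply_one] at hy; omega
  have hp := key _ (by have := hbw (t - 1) (by omega); rw [show t - 1 + 1 = t by omega] at this; exact this.symm) ⟨t - 1, by omega, rfl⟩
  have hi2ne : i₀ + 2 ≠ n := by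
    intro h; rw [h, hn'] at h2; have e0 := congrFun h2 0; have e1 := congrFun h2 1; simp at e0 e1; omega
  by_cases htn : t = n
  · -- `(xb−3, L) = e₀`: its predecessor is `(2,0) = ω (i₀+2)` (not the root, which is `ω 0` with `n ≥ 2`), so `i₀ + 3 = n`
    rcases hp with hp | hp
    · exfalso
      have e0 : (xb - 4 : ℤ) = 0 ∧ L = 0 := by
        rw [htn, hn'] at hωt; have a := congrFun hωt 0; have b := congrFun hωt 1; simp at a b; omega
      have : ω (t - 1) = ω 0 := by rw [hp, h0]; ext j; fin_cases j <;> simp [e0.1, e0.2]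
      have := hinj (show t - 1 ∈ {i | i ≤ n} by simp; omega) (show 0 ∈ {i | i ≤ n} by simp) this; omega
    · rw [← h2] at hp
      have := hinj (show t - 1 ∈ {i | i ≤ n} by simp; omega) (show i₀ + 2 ∈ {i | i ≤ n} by simp; omega) hp
      have hi3 : i₀ + 3 = t := by omega
      exact ⟨by omega, by rw [hi3]; exact hωt⟩
  have hs := key _ (hbw t (by omega)) ⟨t + 1, by omega, rfl⟩
  have hne : ω (t - 1) ≠ ω (t + 1) := by
    intro h; have := hinj (show t - 1 ∈ {i | i ≤ n} by simp; omega) (show t + 1 ∈ {i | i ≤ n} by simp; omega) h; omega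
  have hx : ω (t - 1) = ω (i₀ + 2) ∨ ω (t + 1) = ω (i₀ + 2) := by
    rw [h2]
    rcases hp with hp | hp <;> rcases hs with hs | hs
    · exact absurd (hp.trans hs.symm) hne
    · exact Or.inr hs
    · exact Or.inl hp
    · exact absurd (hp.trans hs.symm) hne
  rcases hx with hx | hx
  · have := hinj (show t - 1 ∈ {i | i ≤ n} by simp; omega) (show i₀ + 2 ∈ {i | i ≤ n} by simp; omega) hx
    have ht' : t = i₀ + 3 := by omega
    refine ⟨by omega, ?_⟩; rw [← ht']; exact hωt
  · have := hinj (show t + 1 ∈ {i | i ≤ n} by simp; omega) (show i₀ + 2 ∈ {i | i ≤ n} by simp; omega) hx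
    have ht' : t = i₀ + 1 := by omega
    rw [ht', h1] at hωt; have := (pt_inj.1 hωt).1; omega

/-- **Beyond a bottom corner NOT of class X♭, forward**: with `ω (i₀−1) = (xb−1,L)`, `ω (i₀−2) = (xb−2,L)` and `(xb−3,L)` off `ω`, the
predecessor `ω (i₀−3)` is `(xb−2, L+1)`. [cite: EntingJensen2009, §7.4.2, Fig. 7.10 (brickwork form of the honeycomb lattice)] -/
theorem notXb_pred_fwd {i₀ : ℕ} (hω : ω ∈ endAt n (Pi.single 0 1 : Site 2)) (hpar : (xb + L) % 2 = 0)
    (hminH : ∀ i, i ≤ n → L ≤ ω i 1) (hi₀ : 2 ≤ i₀) (hi₀n : i₀ ≤ n)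
    (h2 : ω (i₀ - 2) = pt (xb - 2) L) (h1 : ω (i₀ - 1) = pt (xb - 1) L) (hX : ∀ t, t ≤ n → ω t ≠ pt (xb - 3) L) :
    3 ≤ i₀ ∧ ω (i₀ - 3) = pt (xb - 2) (L + 1) := by
  obtain ⟨⟨h0, -, hbw, hinj⟩, hn'⟩ := mem_endAt_iff.1 hω
  -- `i₀ − 2 ≠ 0`: else `(xb−2, L) = (0,0)` and `ω (i₀−1) = (1,0) = ω n`, contradicting `i₀ ≤ n`
  have hne : i₀ - 2 ≠ 0 := by
    intro h; rw [h, h0] at h2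
    have e0 := congrFun h2 0; have e1 := congrFun h2 1; simp at e0 e1
    have : ω (i₀ - 1) = ω n := by rw [h1, hn']; ext j; fin_cases j <;> simp <;> omega
    have := hinj (show i₀ - 1 ∈ {i | i ≤ n} by simp; omega) (show n ∈ {i | i ≤ n} by simp) this; omega
  refine ⟨by omega, ?_⟩
  have hadj : brickWallGraph.Adj (ω (i₀ - 2)) (ω (i₀ - 3)) := by
    have := hbw (i₀ - 3) (by omega); rw [show i₀ - 3 + 1 = i₀ - 2 by omega] at this; exact this.symm
  rw [h2] at hadj
  have hback : ω (i₀ - 3) ≠ ω (i₀ - 1) := by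
    intro h; have := hinj (show i₀ - 3 ∈ {i | i ≤ n} by simp; omega) (show i₀ - 1 ∈ {i | i ≤ n} by simp; omega) h; omega
  have hLt := hminH (i₀ - 3) (by omega)
  rcases adj_cases hadj with ⟨hz0, hz1⟩ | ⟨hz0, hz1⟩ | hz0
  · exfalso; apply hback; rw [h1, bt_site_eq_iff]; simp only [pt_apply_zero, pt_apply_one] at hz0 hz1 ⊢; omega
  · exfalso; apply hX (i₀ - 3) (by omega); rw [bt_site_eq_iff]; simp only [pt_apply_zero, pt_apply_one] at hz0 hz1 ⊢; omega
  · rcases vertical_cases hadj hz0 with ⟨hy, hp⟩ | ⟨hy, hp⟩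
    · rw [bt_site_eq_iff]; simp only [pt_apply_zero, pt_apply_one] at hz0 hy ⊢; omega
    · exfalso; simp only [pt_apply_one] at hy; omega

/-- **Beyond a bottom corner NOT of class X♭, backward**: with `ω (i₀+1) = (xb−1,L)`, `ω (i₀+2) = (xb−2,L)`, `(xb−3,L)` off `ω`, the
successor `ω (i₀+3)` is `(xb−2, L+1)` (and `i₀ + 3 ≤ n`). [cite: EntingJensen2009, §7.4.2, Fig. 7.10 (brickwork form of the honeycomb lattice)] -/
theorem notXb_succ_bwd {i₀ : ℕ} (hω : ω ∈ endAt n (Pi.single 0 1 : Site 2)) (hpar : (xb + L) % 2 = 0)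
    (hminH : ∀ i, i ≤ n → L ≤ ω i 1) (hi₀n : i₀ + 2 ≤ n)
    (h2 : ω (i₀ + 2) = pt (xb - 2) L) (h1 : ω (i₀ + 1) = pt (xb - 1) L) (hX : ∀ t, t ≤ n → ω t ≠ pt (xb - 3) L) :
    i₀ + 3 ≤ n ∧ ω (i₀ + 3) = pt (xb - 2) (L + 1) := by
  obtain ⟨⟨h0, -, hbw, hinj⟩, hn'⟩ := mem_endAt_iff.1 hω
  -- `i₀ + 2 ≠ n`: `(xb−2, L) = (1,0)` contradicts the parity `xb + L` even
  have hne : i₀ + 2 ≠ n := by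
    intro h; rw [h, hn'] at h2; have e0 := congrFun h2 0; have e1 := congrFun h2 1; simp at e0 e1; omega
  refine ⟨by omega, ?_⟩
  have hadj : brickWallGraph.Adj (ω (i₀ + 2)) (ω (i₀ + 3)) := hbw (i₀ + 2) (by omega)
  rw [h2] at hadj
  have hback : ω (i₀ + 3) ≠ ω (i₀ + 1) := by
    intro h; have := hinj (show i₀ + 3 ∈ {i | i ≤ n} by simp; omega) (show i₀ + 1 ∈ {i | i ≤ n} by simp; omega) h; omega
  have hLt := hminH (i₀ + 3) (by omega)
  rcases adj_cases hadj with ⟨hz0, hz1⟩ | ⟨hz0, hz1⟩ | hz0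
  · exfalso; apply hback; rw [h1, bt_site_eq_iff]; simp only [pt_apply_zero, pt_apply_one] at hz0 hz1 ⊢; omega
  · exfalso; apply hX (i₀ + 3) (by omega); rw [bt_site_eq_iff]; simp only [pt_apply_zero, pt_apply_one] at hz0 hz1 ⊢; omega
  · rcases vertical_cases hadj hz0 with ⟨hy, hp⟩ | ⟨hy, hp⟩
    · rw [bt_site_eq_iff]; simp only [pt_apply_zero, pt_apply_one] at hz0 hy ⊢; omega
    · exfalso; simp only [pt_apply_one] at hy; omega

/-! ### Surgery data at the bottom corner -/

/-- **Case X♭ datum**: at a bottom corner with `(xb−3, L) ∈ ω`, the surgery below the bottom run comes with its decoding datum — an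
admissible window position `j` and an orientation `fwd` such that the window reads `(xb−3,L)(xb−2,L)(xb−1,L)` and the corner sits right after
(forward) / before (backward) the window.  (`xb ≥ 4`: the site `(xb−3, L)` is lexicographically `≥ 0` and `xb + L` is even.)
[cite: MadrasSlade1993, §3.2 (proof of Theorem 3.2.3)] -/
theorem stepTwo_data_Xb (hω : ω ∈ canonEnd n) (hn : 2 ≤ n)
    (hminH : ∀ i, i ≤ n → L ≤ ω i 1) (hmaxX : ∀ i, i ≤ n → ω i 1 = L → ω i 0 ≤ xb)
    (hv : ∃ i, i ≤ n ∧ ω i = pt xb L) (hX : ∃ t, t ≤ n ∧ ω t = pt (xb - 3) L) :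
    ∃ (j : ℕ) (fwd : Bool), SpliceAddOK n 2 2 ω j (tpath offXb 4 xb L fwd) ∧
      (∀ s, s ≤ 2 → ω (j + s) = tpath w6A 2 xb L fwd s) ∧
      (fwd = true → ω (j + 3) = pt xb L) ∧ (fwd = false → 1 ≤ j ∧ ω (j - 1) = pt xb L) := by
  obtain ⟨hE, hlex⟩ := mem_canonEnd.1 hω
  obtain ⟨⟨h0, -, hbw, hinj⟩, hn'⟩ := mem_endAt_iff.1 hE
  obtain ⟨L', xb', i₀, hi₀, hi₀n, hv', hL0, hx2, hminH', hmaxX', hdir⟩ := exists_bottom_corner hω hn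
  -- the two corners coincide
  obtain ⟨i₁, hi₁, hv₁⟩ := hv
  have hLL : L' = L := by
    have b := hminH' i₁ hi₁; have c := hminH i₀ (by omega)
    rw [hv₁] at b; rw [hv'] at c; simp only [pt_apply_one] at b c; omega
  subst hLL
  have hxx : xb' = xb := by
    have a := hmaxX i₁ hi₁ (by rw [hv₁]; simp); have b := hmaxX' i₀ (by omega) (by rw [hv']; simp)
    have c := hmaxX' i₁ hi₁ (by rw [hv₁]; simp); have d := hmaxX i₀ (by omega) (by rw [hv']; simp)
    rw [hv₁] at a c; rw [hv'] at b d; simp only [pt_apply_zero] at a b c d; omega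
  subst hxx
  obtain ⟨t, ht, hωt⟩ := hX
  -- the site `(xb−3, L)` is lexicographically `≥ 0`: `xb ≥ 3`, and `xb = 3` would force `L = 0`
  have hx3 : 3 ≤ xb' ∧ (xb' = 3 → L' = 0) := by
    have h := hlex t ht; rw [hωt] at h; unfold LexNonneg at h; simp only [pt_apply_zero, pt_apply_one] at h; omega
  rcases hdir with ⟨hp, hs⟩ | ⟨hs', hp'⟩
  · have hpar : (xb' + L') % 2 = 0 := by
      have hvc := vertical_cases (hbw i₀ (by omega)) (by rw [hv', hs]; simp)
      rw [hv', hs] at hvc; simp only [pt_apply_zero, pt_apply_one] at hvc; omega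
    have hx4 : 4 ≤ xb' := by omega
    obtain ⟨hi₀2, h2⟩ := bottom_corner_pred hω hi₀ hi₀n hv' hx2 hminH' hp hs
    obtain ⟨hi₀3, h3⟩ := caseAb_fwd hE hpar hminH' hi₀2 hi₀n h2 hp ht hωt
    have hw : ∀ s, s ≤ 2 → ω (i₀ - 3 + s) = tpath w6A 2 xb' L' true s := by
      intro s hsL
      interval_cases s
      · exact tpath_eq (by rw [show i₀ - 3 + 0 = i₀ - 3 by omega, h3]) (by simp [rd, w6A])
      · exact tpath_eq (by rw [show i₀ - 3 + 1 = i₀ - 2 by omega, h2]) (by simp [rd, w6A])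
      · exact tpath_eq (by rw [show i₀ - 3 + 2 = i₀ - 1 by omega, hp]) (by simp [rd, w6A])
    exact ⟨i₀ - 3, true, spliceOK_Xb hpar hx4 hminH' hmaxX' hw (by omega), hw,
      fun _ => by rw [show i₀ - 3 + 3 = i₀ by omega, hv'], fun h => absurd h (by decide)⟩
  · have hpar : (xb' + L') % 2 = 0 := by
      have hvc := vertical_cases (hbw (i₀ - 1) (by omega)) (by rw [show i₀ - 1 + 1 = i₀ by omega, hv', hp']; simp)
      rw [show i₀ - 1 + 1 = i₀ by omega, hv', hp'] at hvc; simp only [pt_apply_zero, pt_apply_one] at hvc; omega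
    have hx4 : 4 ≤ xb' := by omega
    -- `i₀ + 2 ≤ n`: `ω (i₀+1) = (xb−1, L)` with `xb − 1 ≥ 3` is not the end `e₀ = (1,0)`
    have hi₀2 : i₀ + 2 ≤ n := by
      by_contra hlt
      have hi : i₀ + 1 = n := by omega
      rw [hi, hn'] at hs'; have := congrFun hs' 0; simp at this; omega
    have h2 := bottom_corner_succ hω hi₀ hi₀2 hv' hminH' hs' hp'
    obtain ⟨hi₀3, h3⟩ := caseAb_bwd hE hpar hminH' hi₀2 h2 hs' ht hωt
    have hw : ∀ s, s ≤ 2 → ω (i₀ + 1 + s) = tpath w6A 2 xb' L' false s := by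
      intro s hsL
      interval_cases s
      · exact tpath_eq (by rw [add_zero, hs']) (by simp [rd, w6A])
      · exact tpath_eq (by rw [show i₀ + 1 + 1 = i₀ + 2 by omega, h2]) (by simp [rd, w6A])
      · exact tpath_eq (by rw [show i₀ + 1 + 2 = i₀ + 3 by omega, h3]) (by simp [rd, w6A])
    exact ⟨i₀ + 1, false, spliceOK_Xb hpar hx4 hminH' hmaxX' hw (by omega), hw,
      fun h => absurd h (by decide), fun _ => ⟨by omega, by rw [show i₀ + 1 - 1 = i₀ by omega, hv']⟩⟩

/-- **Floor datum, forward**: from the run of length `2k` above the corner `ω i₀ = (xb,L)` ending with a step up, the floor surgery with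
window at `j = i₀` is admissible and the window reads `wYsb`. [cite: MadrasSlade1993, §3.2 (proof of Theorem 3.2.3)] -/
theorem stepTwo_data_Ysb_fwd (hω : ω ∈ canonEnd n) {i₀ : ℕ} (hx : 2 ≤ xb) (hk : 1 ≤ k) (hkn : i₀ + 2 * k + 1 ≤ n)
    (hminH : ∀ i, i ≤ n → L ≤ ω i 1) (hmaxX : ∀ i, i ≤ n → ω i 1 = L → ω i 0 ≤ xb)
    (hv : ω i₀ = pt xb L) (hrun : ∀ s, 1 ≤ s → s ≤ 2 * k → ω (i₀ + s) = pt (xb + s - 1) (L + 1))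
    (hup : ω (i₀ + 2 * k + 1) = pt (xb + 2 * k - 1) (L + 2)) :
    SpliceAddOK n 2 (2 * k) ω i₀ (tpath (offYsb k) (2 * k + 2) xb L true) ∧
      (∀ s, s ≤ 2 * k → ω (i₀ + s) = tpath wYsb (2 * k) xb L true s) := by
  obtain ⟨hE, -⟩ := mem_canonEnd.1 hω
  obtain ⟨⟨h0, -, hbw, hinj⟩, hn'⟩ := mem_endAt_iff.1 hE
  have h1 : ω (i₀ + 1) = pt xb (L + 1) := by rw [hrun 1 le_rfl (by omega)]; congr 1; ring
  have hpar : (xb + L) % 2 = 0 := by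
    have hvc := vertical_cases (hbw i₀ (by omega)) (by rw [hv, h1]; simp)
    rw [hv, h1] at hvc; simp only [pt_apply_zero, pt_apply_one] at hvc; omega
  have hlast : ω (i₀ + 2 * k) = pt (xb + 2 * k - 1) (L + 1) := by
    have := hrun (2 * k) (by omega) le_rfl; exact_mod_cast this
  have hE' := caseYb_free hE hpar (by omega) hk hminH hmaxX (a := i₀ + 2 * k) (by omega) (by omega) hlast
    (Or.inl ⟨by rw [show i₀ + 2 * k - 1 = i₀ + (2 * k - 1) by omega, hrun (2 * k - 1) (by omega) (by omega)]; congr 1; omega,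
      hup⟩)
  have hw : ∀ s, s ≤ 2 * k → ω (i₀ + s) = tpath wYsb (2 * k) xb L true s := by
    intro s hs
    rcases Nat.eq_zero_or_pos s with rfl | hs0
    · exact tpath_eq (by rw [add_zero, hv]) (by simp [rd, wYsb])
    · refine tpath_eq (hrun s hs0 hs) ?_
      simp only [rd, ↓reduceIte]; rw [wYsb_pos hs0, Prod.mk.injEq]; exact ⟨by ring, by ring⟩
  exact ⟨spliceOK_Ysb hpar (by omega) hk hminH hmaxX hE' hw (by omega), hw⟩

/-- **Floor datum, backward** (run `ω (i₀−s) = (xb+s−1,L+1)`, `1 ≤ s ≤ 2k`, then `ω (i₀−(2k+1)) = (xb+2k−1,L+2)`): the floor surgery with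
window at `j = i₀ − 2k`, read backwards, is admissible. [cite: MadrasSlade1993, §3.2 (proof of Theorem 3.2.3)] -/
theorem stepTwo_data_Ysb_bwd (hω : ω ∈ canonEnd n) {i₀ : ℕ} (hx : 2 ≤ xb) (hk : 1 ≤ k) (hki : 2 * k + 1 ≤ i₀) (hi₀n : i₀ ≤ n)
    (hminH : ∀ i, i ≤ n → L ≤ ω i 1) (hmaxX : ∀ i, i ≤ n → ω i 1 = L → ω i 0 ≤ xb)
    (hv : ω i₀ = pt xb L) (hrun : ∀ s, 1 ≤ s → s ≤ 2 * k → ω (i₀ - s) = pt (xb + s - 1) (L + 1))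
    (hup : ω (i₀ - (2 * k + 1)) = pt (xb + 2 * k - 1) (L + 2)) :
    SpliceAddOK n 2 (2 * k) ω (i₀ - 2 * k) (tpath (offYsb k) (2 * k + 2) xb L false) ∧
      (∀ s, s ≤ 2 * k → ω (i₀ - 2 * k + s) = tpath wYsb (2 * k) xb L false s) := by
  obtain ⟨hE, -⟩ := mem_canonEnd.1 hω
  obtain ⟨⟨h0, -, hbw, hinj⟩, hn'⟩ := mem_endAt_iff.1 hE
  have h1 : ω (i₀ - 1) = pt xb (L + 1) := by rw [hrun 1 le_rfl (by omega)]; congr 1; ring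
  have hpar : (xb + L) % 2 = 0 := by
    have hvc := vertical_cases (hbw (i₀ - 1) (by omega)) (by rw [show i₀ - 1 + 1 = i₀ by omega, hv, h1]; simp)
    rw [show i₀ - 1 + 1 = i₀ by omega, hv, h1] at hvc; simp only [pt_apply_zero, pt_apply_one] at hvc; omega
  have hlast : ω (i₀ - 2 * k) = pt (xb + 2 * k - 1) (L + 1) := by
    have := hrun (2 * k) (by omega) le_rfl; exact_mod_cast this
  have hE' := caseYb_free hE hpar (by omega) hk hminH hmaxX (a := i₀ - 2 * k) (by omega) (by omega) hlast
    (Or.inr ⟨by rw [show i₀ - 2 * k + 1 = i₀ - (2 * k - 1) by omega, hrun (2 * k - 1) (by omega) (by omega)]; congr 1; omega,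
      by rw [show i₀ - 2 * k - 1 = i₀ - (2 * k + 1) by omega, hup]⟩)
  have hw : ∀ s, s ≤ 2 * k → ω (i₀ - 2 * k + s) = tpath wYsb (2 * k) xb L false s := by
    intro s hs
    rcases Nat.lt_or_ge s (2 * k) with hs2 | hs2
    · refine tpath_eq (by rw [show i₀ - 2 * k + s = i₀ - (2 * k - s) by omega, hrun (2 * k - s) (by omega) (by omega)]) ?_
      simp only [rd, Bool.false_eq_true, ↓reduceIte]; rw [wYsb_pos (by omega), Prod.mk.injEq]; exact ⟨by ring, by ring⟩
    · obtain rfl : s = 2 * k := by omega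
      exact tpath_eq (by rw [show i₀ - 2 * k + 2 * k = i₀ by omega, hv]) (by simp [rd, wYsb])
  exact ⟨spliceOK_Ysb hpar (by omega) hk hminH hmaxX hE' hw (by omega), hw⟩

/-! ### Classification at the bottom corner -/

/-- The second site of a canonical rooted polygon is `(1,1)`: from `ω 1 = (0,1)` the walk cannot step left (abscissa `−1`), down (the
root) or up (no brick-wall bond at the odd site `(0,1)`). [cite: MadrasSlade1993, §3.2 (proof of Theorem 3.2.3: `Q[N]`)] -/
theorem apply_two_of_mem_canonEnd (hω : ω ∈ canonEnd n) (hn : 3 ≤ n) : ω 2 = pt 1 1 := by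
  obtain ⟨hE, hlex⟩ := mem_canonEnd.1 hω
  obtain ⟨⟨h0, -, hbw, hinj⟩, hn'⟩ := mem_endAt_iff.1 hE
  obtain ⟨h10, h11⟩ := apply_one_of_mem_canonEnd hω (by omega)
  have hadj : brickWallGraph.Adj (ω 1) (ω 2) := hbw 1 (by omega)
  have hl := hlex 2 (by omega); unfold LexNonneg at hl
  have hback : ω 2 ≠ ω 0 := by
    intro h; have := hinj (show (2 : ℕ) ∈ {i | i ≤ n} by simp; omega) (show (0 : ℕ) ∈ {i | i ≤ n} by simp) h; omega
  rcases adj_cases hadj with ⟨hz0, hz1⟩ | ⟨hz0, hz1⟩ | hz0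
  · rw [bt_site_eq_iff]; simp only [pt_apply_zero, pt_apply_one]; omega
  · exfalso; omega
  · exfalso
    rcases vertical_cases hadj hz0 with ⟨hy, hp⟩ | ⟨hy, hp⟩
    · omega
    · apply hback; rw [h0]; ext j; fin_cases j <;> simp <;> omega

/-- **Classification at the bottom corner** (every `L ≤ 0`): class X♭ (`(xb−3,L) ∈ ω`), or the floor move applies (above the corner the
walk steps up then RIGHT — then it runs an odd number of steps along `L+1` and steps up; the bottom-row sites beyond the corner are recorded,
the last two only when they are genuine times of the walk: at the corner `(2,0)` next to the end `e₀` they wrap around the root), or the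
BOTTOM LEAF: above the corner the walk steps LEFT.  (At the corner `(2,0)` a LEFT step would close up the hexagon, `n = 5`; the floor
move applies there for every `n ≥ 6`.) [cite: MadrasSlade1993, §3.2 (proof of Theorem 3.2.3: the local structure at an extreme point)] -/
theorem stepTwo_classify_bottom (hω : ω ∈ canonEnd n) (hn : 5 ≤ n) :
    ∃ (L xb : ℤ) (i₀ : ℕ) (fwd : Bool), 1 ≤ i₀ ∧ i₀ + 1 ≤ n ∧ ω i₀ = pt xb L ∧ 2 ≤ xb ∧ L ≤ 0 ∧
      (∀ i, i ≤ n → L ≤ ω i 1) ∧ (∀ i, i ≤ n → ω i 1 = L → ω i 0 ≤ xb) ∧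
      ( (∃ t, t ≤ n ∧ ω t = pt (xb - 3) L) ∨
        ((∀ t, t ≤ n → ω t ≠ pt (xb - 3) L) ∧
          ( (fwd = true ∧ 3 ≤ i₀ ∧ ω (i₀ - 1) = pt (xb - 1) L ∧ ω (i₀ - 2) = pt (xb - 2) L ∧ ω (i₀ - 3) = pt (xb - 2) (L + 1) ∧
              ∃ k, 1 ≤ k ∧ i₀ + 2 * k + 1 ≤ n ∧ (∀ s, 1 ≤ s → s ≤ 2 * k → ω (i₀ + s) = pt (xb + s - 1) (L + 1)) ∧
                ω (i₀ + 2 * k + 1) = pt (xb + 2 * k - 1) (L + 2)) ∨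
            (fwd = false ∧ ω (i₀ + 1) = pt (xb - 1) L ∧
              (i₀ + 2 ≤ n → ω (i₀ + 2) = pt (xb - 2) L ∧ i₀ + 3 ≤ n ∧ ω (i₀ + 3) = pt (xb - 2) (L + 1)) ∧
              ∃ k, 1 ≤ k ∧ 2 * k + 1 ≤ i₀ ∧ (∀ s, 1 ≤ s → s ≤ 2 * k → ω (i₀ - s) = pt (xb + s - 1) (L + 1)) ∧
                ω (i₀ - (2 * k + 1)) = pt (xb + 2 * k - 1) (L + 2)) ∨
            (fwd = true ∧ i₀ + 2 ≤ n ∧ ω (i₀ + 1) = pt xb (L + 1) ∧ ω (i₀ + 2) = pt (xb - 1) (L + 1)) ∨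
            (fwd = false ∧ 2 ≤ i₀ ∧ ω (i₀ - 1) = pt xb (L + 1) ∧ ω (i₀ - 2) = pt (xb - 1) (L + 1))))) := by
  obtain ⟨hE, hlex⟩ := mem_canonEnd.1 hω
  obtain ⟨⟨h0, -, hbw, hinj⟩, hn'⟩ := mem_endAt_iff.1 hE
  obtain ⟨L, xb, i₀, hi₀, hi₀n, hv, hL0, hx2, hminH, hmaxX, hdir⟩ := exists_bottom_corner hω (by omega)
  rcases hdir with ⟨hp, hs⟩ | ⟨hs', hp'⟩
  · -- forward: `ω (i₀−1) = (xb−1,L)`, `ω (i₀+1) = (xb,L+1)`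
    have hpar : (xb + L) % 2 = 0 := by
      have hvc := vertical_cases (hbw i₀ (by omega)) (by rw [hv, hs]; simp)
      rw [hv, hs] at hvc; simp only [pt_apply_zero, pt_apply_one] at hvc; omega
    obtain ⟨hi₀2, h2⟩ := bottom_corner_pred hω hi₀ hi₀n hv hx2 hminH hp hs
    refine ⟨L, xb, i₀, true, hi₀, hi₀n, hv, hx2, hL0, hminH, hmaxX, ?_⟩
    by_cases hX : ∃ t, t ≤ n ∧ ω t = pt (xb - 3) L
    · exact Or.inl hX
    push Not at hX
    refine Or.inr ⟨hX, ?_⟩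
    obtain ⟨hi₀3, h3⟩ := notXb_pred_fwd hE hpar hminH hi₀2 (by omega) h2 hp hX
    obtain ⟨hi₀2', hstep⟩ := caseYb_step1_fwd hE hpar hx2 hi₀n hv hs
    rcases hstep with hLft | hR
    · exact Or.inr (Or.inr (Or.inl ⟨rfl, hi₀2', hs, hLft⟩))
    · obtain ⟨k, hk, hkn, hrun, hup⟩ := exists_floor_run_fwd hE hpar hx2 hmaxX hi₀2' hs hR
      exact Or.inl ⟨rfl, hi₀3, hp, h2, h3, k, hk, hkn, hrun, hup⟩
  · -- backward: `ω (i₀+1) = (xb−1,L)`, `ω (i₀−1) = (xb,L+1)`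
    have hpar : (xb + L) % 2 = 0 := by
      have hvc := vertical_cases (hbw (i₀ - 1) (by omega)) (by rw [show i₀ - 1 + 1 = i₀ by omega, hv, hp']; simp)
      rw [show i₀ - 1 + 1 = i₀ by omega, hv, hp'] at hvc; simp only [pt_apply_zero, pt_apply_one] at hvc; omega
    refine ⟨L, xb, i₀, false, hi₀, hi₀n, hv, hx2, hL0, hminH, hmaxX, ?_⟩
    by_cases hX : ∃ t, t ≤ n ∧ ω t = pt (xb - 3) L
    · exact Or.inl hX
    push Not at hX
    refine Or.inr ⟨hX, ?_⟩
    -- the post-corner facts, when `i₀ + 2 ≤ n`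
    have hpost : i₀ + 2 ≤ n → ω (i₀ + 2) = pt (xb - 2) L ∧ i₀ + 3 ≤ n ∧ ω (i₀ + 3) = pt (xb - 2) (L + 1) := by
      intro hi₀2
      have h2 := bottom_corner_succ hω hi₀ hi₀2 hv hminH hs' hp'
      obtain ⟨hi₀3, h3⟩ := notXb_succ_bwd hE hpar hminH hi₀2 h2 hs' hX
      exact ⟨h2, hi₀3, h3⟩
    obtain ⟨hi₀2', hstep⟩ := caseYb_step1_bwd hE hpar hx2 hi₀ (by omega) hv hp'
    rcases hstep with hLft | hR
    · exact Or.inr (Or.inr (Or.inr ⟨rfl, hi₀2', hp', hLft⟩))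
    · obtain ⟨k, hk, hki, hrun, hup⟩ := exists_floor_run_bwd hE hpar hx2 hmaxX hi₀2' (by omega) hp' hR
      exact Or.inr (Or.inl ⟨rfl, hs', hpost, k, hk, hki, hrun, hup⟩)

/-! ### Decoding the bottom images -/

/-- **Bottom corner of a case-X♭ image**: `(xb − 1, L − 1)`, at table index `3`. [cite: MadrasSlade1993, §3.2] -/
theorem botAt_spliceXb (hminH : ∀ i, i ≤ n → L ≤ ω i 1) (hmaxX : ∀ i, i ≤ n → ω i 1 = L → ω i 0 ≤ xb)
    (hP : SpliceAddOK n 2 2 ω j (tpath offXb 4 xb L fwd)) :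
    BotSix (n + 2) (spliceAdd 2 2 ω (tpath offXb 4 xb L fwd) j) (L + (-1)) (xb + (-1)) (j + rd fwd 4 3) :=
  botAt_spliceAdd hminH hmaxX hP (by norm_num) (by omega) (fun u hu => by
    interval_cases u <;> simp only [offXb] <;> omega) (by norm_num) rfl

/-- **Bottom corner of a floor image**: `(xb + 2k, L)`, at table index `2k`. [cite: MadrasSlade1993, §3.2] -/
theorem botAt_spliceYsb (hminH : ∀ i, i ≤ n → L ≤ ω i 1) (hmaxX : ∀ i, i ≤ n → ω i 1 = L → ω i 0 ≤ xb)
    (hP : SpliceAddOK n 2 (2 * k) ω j (tpath (offYsb k) (2 * k + 2) xb L fwd)) :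
    BotSix (n + 2) (spliceAdd 2 (2 * k) ω (tpath (offYsb k) (2 * k + 2) xb L fwd) j) (L + 0) (xb + 2 * k)
      (j + rd fwd (2 * k + 2) (2 * k)) := by
  have htab : ∀ u, u ≤ 2 * k + 2 → 0 ≤ (offYsb k u).2 ∧ ((offYsb k u).2 = 0 → (offYsb k u).1 ≤ 2 * (k : ℤ)) := by
    intro u hu
    unfold offYsb
    split_ifs with h1 h2
    · exact ⟨le_rfl, fun _ => by change (u : ℤ) ≤ 2 * (k : ℤ); exact_mod_cast h1⟩
    · exact ⟨by change (0 : ℤ) ≤ 1; norm_num, fun h => absurd h (by change (1 : ℤ) ≠ 0; norm_num)⟩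
    · exact ⟨by change (0 : ℤ) ≤ 1; norm_num, fun h => absurd h (by change (1 : ℤ) ≠ 0; norm_num)⟩
  exact botAt_spliceAdd (dL := 0) (dX := 2 * (k : ℤ)) hminH hmaxX hP le_rfl (fun _ => by positivity) htab (u₀ := 2 * k)
    (by omega) (by simp [offYsb])

/-- **Signature of a case-X♭ image, forward** (`j = i₀ − 3`, `ω (j+3) = (xb,L)`): corner `(xb−1,L−1)` at time `j+3`, then UP to `(xb−1,L)`
at `j+4`, then RIGHT to the old corner `(xb,L)` at `j+5`. [cite: MadrasSlade1993, §3.2 (proof of Theorem 3.2.3)] -/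
theorem spliceXb_signature_fwd (hP : SpliceAddOK n 2 2 ω j (tpath offXb 4 xb L true)) (hv : ω (j + 3) = pt xb L) :
    spliceAdd 2 2 ω (tpath offXb 4 xb L true) j (j + 3) = pt (xb - 1) (L - 1) ∧
    spliceAdd 2 2 ω (tpath offXb 4 xb L true) j (j + 4) = pt (xb - 1) L ∧
    spliceAdd 2 2 ω (tpath offXb 4 xb L true) j (j + 5) = pt xb L := by
  refine ⟨?_, ?_, ?_⟩
  · rw [spliceAdd_mid hP.start (by norm_num)]; simp [tpath, rd, offXb]; ring_nf
  · rw [spliceAdd_mid hP.start (by norm_num)]; simp [tpath, rd, offXb]; ring_nf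
  · rw [spliceAdd_of_ge hP.finish (by omega), show j + 5 - 2 = j + 3 by omega, hv]

/-- **Signature of a case-X♭ image, backward** (`j = i₀ + 1`, `ω (j−1) = (xb,L)`): the old corner at `j−1`, LEFT to `(xb−1,L)` at `j`,
DOWN to the corner `(xb−1,L−1)` at `j+1`, then `(xb−2,L−1)` at `j+2`. [cite: MadrasSlade1993, §3.2 (proof of Theorem 3.2.3)] -/
theorem spliceXb_signature_bwd (hP : SpliceAddOK n 2 2 ω j (tpath offXb 4 xb L false)) (hj : 1 ≤ j) (hv : ω (j - 1) = pt xb L) :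
    spliceAdd 2 2 ω (tpath offXb 4 xb L false) j (j - 1) = pt xb L ∧
    spliceAdd 2 2 ω (tpath offXb 4 xb L false) j j = pt (xb - 1) L ∧
    spliceAdd 2 2 ω (tpath offXb 4 xb L false) j (j + 1) = pt (xb - 1) (L - 1) ∧
    spliceAdd 2 2 ω (tpath offXb 4 xb L false) j (j + 2) = pt (xb - 2) (L - 1) := by
  refine ⟨?_, ?_, ?_, ?_⟩
  · rw [spliceAdd_of_le (by omega), hv]
  · have := spliceAdd_mid (K := 2) (L := 2) (ω := ω) (j := j) hP.start (s := 0) (by norm_num)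
    rw [add_zero] at this; rw [this]; simp [tpath, rd, offXb]; ring_nf
  · rw [spliceAdd_mid hP.start (by norm_num)]; simp [tpath, rd, offXb]; ring_nf
  · rw [spliceAdd_mid hP.start (by norm_num)]; simp [tpath, rd, offXb]; ring_nf

/-- **Decoding within case X♭**. [cite: MadrasSlade1993, §3.2 (proof of Theorem 3.2.3: "Q can be unambiguously determined")] -/
theorem spliceXb_decode {ω₁ ω₂ : ℕ → Site 2} {xb₁ L₁ xb₂ L₂ : ℤ} {j₁ j₂ : ℕ} {fwd₁ fwd₂ : Bool}
    (hω₁ : ω₁ ∈ canonEnd n) (hω₂ : ω₂ ∈ canonEnd n)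
    (hminH₁ : ∀ i, i ≤ n → L₁ ≤ ω₁ i 1) (hmaxX₁ : ∀ i, i ≤ n → ω₁ i 1 = L₁ → ω₁ i 0 ≤ xb₁)
    (hminH₂ : ∀ i, i ≤ n → L₂ ≤ ω₂ i 1) (hmaxX₂ : ∀ i, i ≤ n → ω₂ i 1 = L₂ → ω₂ i 0 ≤ xb₂)
    (hP₁ : SpliceAddOK n 2 2 ω₁ j₁ (tpath offXb 4 xb₁ L₁ fwd₁)) (hP₂ : SpliceAddOK n 2 2 ω₂ j₂ (tpath offXb 4 xb₂ L₂ fwd₂))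
    (hw₁ : ∀ s, s ≤ 2 → ω₁ (j₁ + s) = tpath w6A 2 xb₁ L₁ fwd₁ s) (hw₂ : ∀ s, s ≤ 2 → ω₂ (j₂ + s) = tpath w6A 2 xb₂ L₂ fwd₂ s)
    (hvf₁ : fwd₁ = true → ω₁ (j₁ + 3) = pt xb₁ L₁) (hvf₂ : fwd₂ = true → ω₂ (j₂ + 3) = pt xb₂ L₂)
    (hvb₁ : fwd₁ = false → 1 ≤ j₁ ∧ ω₁ (j₁ - 1) = pt xb₁ L₁) (hvb₂ : fwd₂ = false → 1 ≤ j₂ ∧ ω₂ (j₂ - 1) = pt xb₂ L₂)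
    (h : spliceAdd 2 2 ω₁ (tpath offXb 4 xb₁ L₁ fwd₁) j₁ = spliceAdd 2 2 ω₂ (tpath offXb 4 xb₂ L₂ fwd₂) j₂) : ω₁ = ω₂ := by
  obtain ⟨hE₁, -⟩ := mem_canonEnd.1 hω₁
  obtain ⟨hE₂, -⟩ := mem_canonEnd.1 hω₂
  have hW : spliceAdd 2 2 ω₁ (tpath offXb 4 xb₁ L₁ fwd₁) j₁ ∈ endAt (n + 2) (Pi.single 0 1 : Site 2) := spliceAdd_mem hE₁ hP₁
  have hinj := (mem_endAt_iff.1 hW).1.2.2.2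
  have T₁ := botAt_spliceXb hminH₁ hmaxX₁ hP₁
  have T₂ := botAt_spliceXb hminH₂ hmaxX₂ hP₂
  rw [← h] at T₂
  obtain ⟨eH, ex, eτ⟩ := botAt_unique hinj T₁ T₂
  have eH' : L₁ = L₂ := by omega
  have ex' : xb₁ = xb₂ := by omega
  subst eH' ex'
  cases fwd₁ <;> cases fwd₂ <;> simp only [rd, Bool.false_eq_true, ↓reduceIte] at eτ
  · have ej : j₁ = j₂ := by omega
    subst ej
    exact eq_of_spliceAdd_eq hE₁ hE₂ hP₁ hP₂ hw₁ hw₂ h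
  · exfalso
    obtain ⟨-, -, -, e2⟩ := spliceXb_signature_bwd hP₁ (hvb₁ rfl).1 (hvb₁ rfl).2
    obtain ⟨-, h4, -⟩ := spliceXb_signature_fwd hP₂ (hvf₂ rfl)
    rw [h, show j₁ + 2 = j₂ + 4 by omega, h4] at e2
    have := (pt_inj.1 e2).2; omega
  · exfalso
    obtain ⟨-, -, -, e2⟩ := spliceXb_signature_bwd hP₂ (hvb₂ rfl).1 (hvb₂ rfl).2
    obtain ⟨-, h4, -⟩ := spliceXb_signature_fwd hP₁ (hvf₁ rfl)
    rw [← h, show j₂ + 2 = j₁ + 4 by omega, h4] at e2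
    have := (pt_inj.1 e2).2; omega
  · have ej : j₁ = j₂ := by omega
    subst ej
    exact eq_of_spliceAdd_eq hE₁ hE₂ hP₁ hP₂ hw₁ hw₂ h

/-- **Sites of a floor image, forward** (window at `j`): the floor `(xb+u, L)` at times `j+u` (`u ≤ 2k`), then `(xb+2k, L+1)` at
`j+2k+1` and `(xb+2k−1, L+1)` at `j+2k+2`. [cite: MadrasSlade1993, §3.2 (proof of Theorem 3.2.3)] -/
theorem spliceYsb_sites_fwd (hP : SpliceAddOK n 2 (2 * k) ω j (tpath (offYsb k) (2 * k + 2) xb L true)) :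
    (∀ u, u ≤ 2 * k → spliceAdd 2 (2 * k) ω (tpath (offYsb k) (2 * k + 2) xb L true) j (j + u) = pt (xb + u) L) ∧
    spliceAdd 2 (2 * k) ω (tpath (offYsb k) (2 * k + 2) xb L true) j (j + (2 * k + 1)) = pt (xb + 2 * k) (L + 1) ∧
    spliceAdd 2 (2 * k) ω (tpath (offYsb k) (2 * k + 2) xb L true) j (j + (2 * k + 2)) = pt (xb + 2 * k - 1) (L + 1) := by
  refine ⟨fun u hu => ?_, ?_, ?_⟩
  · rw [spliceAdd_mid hP.start (by omega)]; simp only [tpath, rd, ↓reduceIte]; unfold offYsb; rw [if_pos hu]; simp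
  · rw [spliceAdd_mid hP.start (by omega)]; simp only [tpath, rd, ↓reduceIte]; unfold offYsb
    rw [if_neg (by omega), if_pos rfl]
  · rw [spliceAdd_mid hP.start (by omega)]; simp only [tpath, rd, ↓reduceIte]; unfold offYsb
    rw [if_neg (by omega), if_neg (by omega)]; exact pt_inj.2 ⟨by ring, rfl⟩

/-- **Sites of a floor image, backward** (window at `j`): `(xb+2k−1,L+1)` at `j`, `(xb+2k,L+1)` at `j+1`, then the floor `(xb+2k−u, L)` at
times `j+2+u` (`u ≤ 2k`). [cite: MadrasSlade1993, §3.2 (proof of Theorem 3.2.3)] -/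
theorem spliceYsb_sites_bwd (hP : SpliceAddOK n 2 (2 * k) ω j (tpath (offYsb k) (2 * k + 2) xb L false)) :
    (∀ u, u ≤ 2 * k → spliceAdd 2 (2 * k) ω (tpath (offYsb k) (2 * k + 2) xb L false) j (j + (2 + u)) = pt (xb + 2 * k - u) L) ∧
    spliceAdd 2 (2 * k) ω (tpath (offYsb k) (2 * k + 2) xb L false) j (j + 1) = pt (xb + 2 * k) (L + 1) ∧
    spliceAdd 2 (2 * k) ω (tpath (offYsb k) (2 * k + 2) xb L false) j j = pt (xb + 2 * k - 1) (L + 1) := by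
  refine ⟨fun u hu => ?_, ?_, ?_⟩
  · rw [spliceAdd_mid hP.start (by omega)]; simp only [tpath, rd, Bool.false_eq_true, ↓reduceIte]; unfold offYsb
    rw [if_pos (by omega)]; exact pt_inj.2 ⟨by omega, by ring⟩
  · rw [spliceAdd_mid hP.start (by omega)]; simp only [tpath, rd, Bool.false_eq_true, ↓reduceIte]; unfold offYsb
    rw [if_neg (by omega), if_pos (by omega)]
  · have h := spliceAdd_mid (K := 2) (L := 2 * k) (ω := ω) (j := j) hP.start (s := 0) (by omega)
    rw [add_zero] at h; rw [h]; simp only [tpath, rd, Bool.false_eq_true, ↓reduceIte]; unfold offYsb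
    rw [if_neg (by omega), if_neg (by omega)]; exact pt_inj.2 ⟨by ring, rfl⟩

/-- **Heights around a floor image's corner, forward** (with the three pre-window sites of a source NOT of class X♭): the sites at times
`j−2, …, j+2k` all have height `L`, the site at time `j−3` has height `L+1`. [cite: MadrasSlade1993, §3.2 (proof of Theorem 3.2.3)] -/
theorem spliceYsb_heights_fwd (hP : SpliceAddOK n 2 (2 * k) ω j (tpath (offYsb k) (2 * k + 2) xb L true)) (hj : 3 ≤ j)
    (hp1 : ω (j - 1) = pt (xb - 1) L) (hp2 : ω (j - 2) = pt (xb - 2) L) (hp3 : ω (j - 3) = pt (xb - 2) (L + 1)) :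
    (∀ i, j - 2 ≤ i → i ≤ j + 2 * k → spliceAdd 2 (2 * k) ω (tpath (offYsb k) (2 * k + 2) xb L true) j i 1 = L) ∧
    spliceAdd 2 (2 * k) ω (tpath (offYsb k) (2 * k + 2) xb L true) j (j - 3) 1 = L + 1 := by
  refine ⟨fun i hi1 hi2 => ?_, by rw [spliceAdd_of_le (by omega), hp3]; simp⟩
  rcases Nat.lt_or_ge i j with h | h
  · rw [spliceAdd_of_le h.le]
    rcases Nat.lt_or_ge i (j - 1) with h' | h'
    · rw [show i = j - 2 by omega, hp2]; simp
    · rw [show i = j - 1 by omega, hp1]; simp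
  · obtain ⟨u, rfl⟩ : ∃ u, i = j + u := ⟨i - j, by omega⟩
    rw [(spliceYsb_sites_fwd hP).1 u (by omega)]; simp

/-- **Heights around a floor image's corner, backward** (with the first post-window site `ω (j+2k+1) = (xb−1, L)`): the sites at times
`j+2, …, j+2k+3` have height `L`. [cite: MadrasSlade1993, §3.2 (proof of Theorem 3.2.3)] -/
theorem spliceYsb_heights_bwd (hP : SpliceAddOK n 2 (2 * k) ω j (tpath (offYsb k) (2 * k + 2) xb L false))
    (hs1 : ω (j + 2 * k + 1) = pt (xb - 1) L) :
    ∀ i, j + 2 ≤ i → i ≤ j + 2 * k + 3 → spliceAdd 2 (2 * k) ω (tpath (offYsb k) (2 * k + 2) xb L false) j i 1 = L := by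
  intro i hi1 hi2
  rcases Nat.lt_or_ge i (j + 2 * k + 3) with h | h
  · obtain ⟨u, rfl⟩ : ∃ u, i = j + (2 + u) := ⟨i - j - 2, by omega⟩
    rw [(spliceYsb_sites_bwd hP).1 u (by omega)]; simp
  · rw [spliceAdd_of_ge hP.finish (by omega), show i - 2 = j + 2 * k + 1 by omega, hs1]; simp

/-- **Heights beyond the bottom-row run, backward** (with the second and third post-window sites of a source NOT of class X♭ whose
corner is not next to the end of the walk): time `j+2k+4` has height `L`, time `j+2k+5` has height `L+1`.
[cite: MadrasSlade1993, §3.2 (proof of Theorem 3.2.3)] -/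
theorem spliceYsb_heights_bwd' (hP : SpliceAddOK n 2 (2 * k) ω j (tpath (offYsb k) (2 * k + 2) xb L false))
    (hs2 : ω (j + 2 * k + 2) = pt (xb - 2) L) (hs3 : ω (j + 2 * k + 3) = pt (xb - 2) (L + 1)) :
    spliceAdd 2 (2 * k) ω (tpath (offYsb k) (2 * k + 2) xb L false) j (j + 2 * k + 4) 1 = L ∧
    spliceAdd 2 (2 * k) ω (tpath (offYsb k) (2 * k + 2) xb L false) j (j + 2 * k + 5) 1 = L + 1 := by
  refine ⟨?_, ?_⟩
  · rw [spliceAdd_of_ge hP.finish (by omega), show j + 2 * k + 4 - 2 = j + 2 * k + 2 by omega, hs2]; simp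
  · rw [spliceAdd_of_ge hP.finish (by omega), show j + 2 * k + 5 - 2 = j + 2 * k + 3 by omega, hs3]; simp

/-- **Decoding within the floor class**: two canonical polygons NOT of class X♭ with floor surgeries whose images coincide are EQUAL —
the image's bottom corner pins `L`, `xb + 2k` and the corner time; the site after the corner time pins the orientation; the bottom-row run
ending at the corner has exactly `2k+3` sites, which pins `k` (backward, the run of the LONGER `k` is compared with the turn of the shorter
one, whose corner is then not next to the end of the walk, so its post-window facts are available).
[cite: MadrasSlade1993, §3.2 (proof of Theorem 3.2.3: "Q can be unambiguously determined")] -/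
theorem spliceYsb_decode {ω₁ ω₂ : ℕ → Site 2} {xb₁ L₁ xb₂ L₂ : ℤ} {j₁ j₂ k₁ k₂ : ℕ} {fwd₁ fwd₂ : Bool}
    (hω₁ : ω₁ ∈ canonEnd n) (hω₂ : ω₂ ∈ canonEnd n) (hk₁ : 1 ≤ k₁) (hk₂ : 1 ≤ k₂)
    (hminH₁ : ∀ i, i ≤ n → L₁ ≤ ω₁ i 1) (hmaxX₁ : ∀ i, i ≤ n → ω₁ i 1 = L₁ → ω₁ i 0 ≤ xb₁)
    (hminH₂ : ∀ i, i ≤ n → L₂ ≤ ω₂ i 1) (hmaxX₂ : ∀ i, i ≤ n → ω₂ i 1 = L₂ → ω₂ i 0 ≤ xb₂)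
    (hP₁ : SpliceAddOK n 2 (2 * k₁) ω₁ j₁ (tpath (offYsb k₁) (2 * k₁ + 2) xb₁ L₁ fwd₁))
    (hP₂ : SpliceAddOK n 2 (2 * k₂) ω₂ j₂ (tpath (offYsb k₂) (2 * k₂ + 2) xb₂ L₂ fwd₂))
    (hw₁ : ∀ s, s ≤ 2 * k₁ → ω₁ (j₁ + s) = tpath wYsb (2 * k₁) xb₁ L₁ fwd₁ s)
    (hw₂ : ∀ s, s ≤ 2 * k₂ → ω₂ (j₂ + s) = tpath wYsb (2 * k₂) xb₂ L₂ fwd₂ s)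
    (hpre₁ : fwd₁ = true → 3 ≤ j₁ ∧ ω₁ (j₁ - 1) = pt (xb₁ - 1) L₁ ∧ ω₁ (j₁ - 2) = pt (xb₁ - 2) L₁ ∧ ω₁ (j₁ - 3) = pt (xb₁ - 2) (L₁ + 1))
    (hpost₁ : fwd₁ = false → ω₁ (j₁ + 2 * k₁ + 1) = pt (xb₁ - 1) L₁ ∧ (j₁ + 2 * k₁ + 2 ≤ n →
      ω₁ (j₁ + 2 * k₁ + 2) = pt (xb₁ - 2) L₁ ∧ ω₁ (j₁ + 2 * k₁ + 3) = pt (xb₁ - 2) (L₁ + 1)))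
    (hpre₂ : fwd₂ = true → 3 ≤ j₂ ∧ ω₂ (j₂ - 1) = pt (xb₂ - 1) L₂ ∧ ω₂ (j₂ - 2) = pt (xb₂ - 2) L₂ ∧ ω₂ (j₂ - 3) = pt (xb₂ - 2) (L₂ + 1))
    (hpost₂ : fwd₂ = false → ω₂ (j₂ + 2 * k₂ + 1) = pt (xb₂ - 1) L₂ ∧ (j₂ + 2 * k₂ + 2 ≤ n →
      ω₂ (j₂ + 2 * k₂ + 2) = pt (xb₂ - 2) L₂ ∧ ω₂ (j₂ + 2 * k₂ + 3) = pt (xb₂ - 2) (L₂ + 1)))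
    (h : spliceAdd 2 (2 * k₁) ω₁ (tpath (offYsb k₁) (2 * k₁ + 2) xb₁ L₁ fwd₁) j₁ =
      spliceAdd 2 (2 * k₂) ω₂ (tpath (offYsb k₂) (2 * k₂ + 2) xb₂ L₂ fwd₂) j₂) : ω₁ = ω₂ := by
  obtain ⟨hE₁, -⟩ := mem_canonEnd.1 hω₁
  obtain ⟨hE₂, -⟩ := mem_canonEnd.1 hω₂
  have hW : spliceAdd 2 (2 * k₁) ω₁ (tpath (offYsb k₁) (2 * k₁ + 2) xb₁ L₁ fwd₁) j₁ ∈ endAt (n + 2) (Pi.single 0 1 : Site 2) :=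
    spliceAdd_mem hE₁ hP₁
  have hinj := (mem_endAt_iff.1 hW).1.2.2.2
  have hwnd₁ := hP₁.wnd
  have hwnd₂ := hP₂.wnd
  have T₁ := botAt_spliceYsb hminH₁ hmaxX₁ hP₁
  have T₂ := botAt_spliceYsb hminH₂ hmaxX₂ hP₂
  rw [← h] at T₂
  obtain ⟨eH, ex, eτ⟩ := botAt_unique hinj T₁ T₂
  have eH' : L₁ = L₂ := by omega
  subst eH'
  cases fwd₁ <;> cases fwd₂ <;> simp only [rd, Bool.false_eq_true, ↓reduceIte] at eτ
  · have ej : j₁ = j₂ := by omega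
    subst ej
    obtain ⟨q1, q23⟩ := hpost₁ rfl
    obtain ⟨r1, r23⟩ := hpost₂ rfl
    have A₁ := spliceYsb_heights_bwd hP₁ q1
    have A₂ := spliceYsb_heights_bwd hP₂ r1
    rw [← h] at A₂
    have ek : k₁ = k₂ := by
      rcases Nat.lt_trichotomy k₁ k₂ with hlt | heq | hgt
      · exfalso
        obtain ⟨q2, q3⟩ := q23 (by omega)
        have a := (spliceYsb_heights_bwd' hP₁ q2 q3).2
        have b := A₂ (j₁ + 2 * k₁ + 5) (by omega) (by omega)
        rw [a] at b; omega
      · exact heq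
      · exfalso
        obtain ⟨r2, r3⟩ := r23 (by omega)
        have a := (spliceYsb_heights_bwd' hP₂ r2 r3).2
        rw [← h] at a
        have b := A₁ (j₁ + 2 * k₂ + 5) (by omega) (by omega)
        rw [a] at b; omega
    subst ek
    have exm : xb₁ = xb₂ := by omega
    subst exm
    exact eq_of_spliceAdd_eq hE₁ hE₂ hP₁ hP₂ hw₁ hw₂ h
  · exfalso
    have a := (spliceYsb_sites_bwd hP₁).1 1 (by omega)
    have b := (spliceYsb_sites_fwd hP₂).2.1
    rw [← h, show j₂ + (2 * k₂ + 1) = j₁ + (2 + 1) by omega, a] at b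
    have := (pt_inj.1 b).2; omega
  · exfalso
    have a := (spliceYsb_sites_bwd hP₂).1 1 (by omega)
    have b := (spliceYsb_sites_fwd hP₁).2.1
    rw [h, show j₁ + (2 * k₁ + 1) = j₂ + (2 + 1) by omega, a] at b
    have := (pt_inj.1 b).2; omega
  · obtain ⟨hj₁, q1, q2, q3⟩ := hpre₁ rfl
    obtain ⟨hj₂, r1, r2, r3⟩ := hpre₂ rfl
    have A₁ := spliceYsb_heights_fwd hP₁ hj₁ q1 q2 q3
    have A₂ := spliceYsb_heights_fwd hP₂ hj₂ r1 r2 r3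
    rw [← h] at A₂
    have ek : k₁ = k₂ := by
      rcases Nat.lt_trichotomy k₁ k₂ with hlt | heq | hgt
      · exfalso
        have a := A₁.2; have b := A₂.1 (j₁ - 3) (by omega) (by omega)
        rw [a] at b; omega
      · exact heq
      · exfalso
        have a := A₂.2; have b := A₁.1 (j₂ - 3) (by omega) (by omega)
        rw [a] at b; omega
    subst ek
    have ej : j₁ = j₂ := by omega
    subst ej
    have exm : xb₁ = xb₂ := by omega
    subst exm
    exact eq_of_spliceAdd_eq hE₁ hE₂ hP₁ hP₂ hw₁ hw₂ h

/-- **Case-X♭ images and floor images are disjoint**: above the common bottom corner a case-X♭ image turns RIGHT (to the old corner), a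
floor image turns LEFT. [cite: MadrasSlade1993, §3.2 (proof of Theorem 3.2.3)] -/
theorem spliceXb_ne_spliceYsb {ω₁ ω₂ : ℕ → Site 2} {xb₁ L₁ xb₂ L₂ : ℤ} {j₁ j₂ k₂ : ℕ} {fwd₁ fwd₂ : Bool}
    (hω₁ : ω₁ ∈ canonEnd n) (hk₂ : 1 ≤ k₂)
    (hminH₁ : ∀ i, i ≤ n → L₁ ≤ ω₁ i 1) (hmaxX₁ : ∀ i, i ≤ n → ω₁ i 1 = L₁ → ω₁ i 0 ≤ xb₁)
    (hminH₂ : ∀ i, i ≤ n → L₂ ≤ ω₂ i 1) (hmaxX₂ : ∀ i, i ≤ n → ω₂ i 1 = L₂ → ω₂ i 0 ≤ xb₂)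
    (hP₁ : SpliceAddOK n 2 2 ω₁ j₁ (tpath offXb 4 xb₁ L₁ fwd₁))
    (hP₂ : SpliceAddOK n 2 (2 * k₂) ω₂ j₂ (tpath (offYsb k₂) (2 * k₂ + 2) xb₂ L₂ fwd₂))
    (hvf₁ : fwd₁ = true → ω₁ (j₁ + 3) = pt xb₁ L₁) (hvb₁ : fwd₁ = false → 1 ≤ j₁ ∧ ω₁ (j₁ - 1) = pt xb₁ L₁)
    (h : spliceAdd 2 2 ω₁ (tpath offXb 4 xb₁ L₁ fwd₁) j₁ = spliceAdd 2 (2 * k₂) ω₂ (tpath (offYsb k₂) (2 * k₂ + 2) xb₂ L₂ fwd₂) j₂) :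
    False := by
  obtain ⟨hE₁, -⟩ := mem_canonEnd.1 hω₁
  have hW : spliceAdd 2 2 ω₁ (tpath offXb 4 xb₁ L₁ fwd₁) j₁ ∈ endAt (n + 2) (Pi.single 0 1 : Site 2) := spliceAdd_mem hE₁ hP₁
  have hinj := (mem_endAt_iff.1 hW).1.2.2.2
  have T₁ := botAt_spliceXb hminH₁ hmaxX₁ hP₁
  have T₂ := botAt_spliceYsb hminH₂ hmaxX₂ hP₂
  rw [← h] at T₂
  obtain ⟨eH, ex, eτ⟩ := botAt_unique hinj T₁ T₂
  cases fwd₁ <;> cases fwd₂ <;> simp only [rd, Bool.false_eq_true, ↓reduceIte] at eτ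
  · -- X♭ backward (corner at j₁+1), floor backward (corner at j₂+2): compare time corner − 2
    obtain ⟨e, -, -, -⟩ := spliceXb_signature_bwd hP₁ (hvb₁ rfl).1 (hvb₁ rfl).2
    have b := (spliceYsb_sites_bwd hP₂).2.2
    rw [← h, show j₂ = j₁ - 1 by omega, e] at b
    have := (pt_inj.1 b).1; omega
  · -- X♭ backward, floor forward (corner at j₂+2k₂): compare time corner − 1
    obtain ⟨-, h0, -, -⟩ := spliceXb_signature_bwd hP₁ (hvb₁ rfl).1 (hvb₁ rfl).2
    have b := (spliceYsb_sites_fwd hP₂).1 (2 * k₂ - 1) (by omega)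
    rw [← h, show j₂ + (2 * k₂ - 1) = j₁ by omega, h0] at b
    have := (pt_inj.1 b).2; omega
  · -- X♭ forward (corner at j₁+3), floor backward (corner at j₂+2): compare time corner + 1
    obtain ⟨-, h4, -⟩ := spliceXb_signature_fwd hP₁ (hvf₁ rfl)
    have b := (spliceYsb_sites_bwd hP₂).1 1 (by omega)
    rw [← h, show j₂ + (2 + 1) = j₁ + 4 by omega, h4] at b
    have := (pt_inj.1 b).2; omega
  · -- both forward: compare time corner + 2
    obtain ⟨-, -, h5⟩ := spliceXb_signature_fwd hP₁ (hvf₁ rfl)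
    have b := (spliceYsb_sites_fwd hP₂).2.2
    rw [← h, show j₂ + (2 * k₂ + 2) = j₁ + 5 by omega, h5] at b
    have := (pt_inj.1 b).1; omega

end BottomMoves

/-! ### The bottom class and its images -/

section BottomClass

/-- **The bottom-served class** (second slot of the two-corner injection): a bottom-corner datum `(L, xb, i₀)` of a polygon with at
least two rows of hexagons (some site at height `≥ L + 2`), and EITHER `(xb−3, L)` on `ω` (class X♭) OR — for a polygon with at least
THREE rows (some site at height `≥ L + 3`) — the floor configuration (forward / backward) with its run length `k ≥ 1` and the bottom-row
sites beyond the corner (backward: the last two only when they are genuine times of the walk — at the corner `(2,0)` next to the end `e₀`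
they wrap around the root).  (A two-row polygon in the floor configuration whose top-right hexagon is a leaf is the dihexagon, `n = 9`;
so for the leaf class and `n ≥ 13` the extra row costs nothing.) [cite: MadrasSlade1993, §3.2 (proof of Theorem 3.2.3: surgery at an extreme point)] -/
def IsStepTwoBottom (n : ℕ) (ω : ℕ → Site 2) : Prop :=
  ∃ (L xb : ℤ) (i₀ : ℕ), i₀ + 1 ≤ n ∧ ω i₀ = pt xb L ∧ 2 ≤ xb ∧ (∃ i, i ≤ n ∧ L + 2 ≤ ω i 1) ∧
    (∀ i, i ≤ n → L ≤ ω i 1) ∧ (∀ i, i ≤ n → ω i 1 = L → ω i 0 ≤ xb) ∧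
    ((∃ t, t ≤ n ∧ ω t = pt (xb - 3) L) ∨
      ((∃ i, i ≤ n ∧ L + 3 ≤ ω i 1) ∧ 3 ≤ i₀ ∧ ω (i₀ - 1) = pt (xb - 1) L ∧ ω (i₀ - 2) = pt (xb - 2) L ∧ ω (i₀ - 3) = pt (xb - 2) (L + 1) ∧
        ∃ k, 1 ≤ k ∧ i₀ + 2 * k + 1 ≤ n ∧ (∀ s, 1 ≤ s → s ≤ 2 * k → ω (i₀ + s) = pt (xb + s - 1) (L + 1)) ∧
          ω (i₀ + 2 * k + 1) = pt (xb + 2 * k - 1) (L + 2)) ∨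
      ((∃ i, i ≤ n ∧ L + 3 ≤ ω i 1) ∧ ω (i₀ + 1) = pt (xb - 1) L ∧
        (i₀ + 2 ≤ n → ω (i₀ + 2) = pt (xb - 2) L ∧ i₀ + 3 ≤ n ∧ ω (i₀ + 3) = pt (xb - 2) (L + 1)) ∧
        ∃ k, 1 ≤ k ∧ 2 * k + 1 ≤ i₀ ∧ (∀ s, 1 ≤ s → s ≤ 2 * k → ω (i₀ - s) = pt (xb + s - 1) (L + 1)) ∧
          ω (i₀ - (2 * k + 1)) = pt (xb + 2 * k - 1) (L + 2)))

/-- The decoding datum of a bottom image: a case-X♭ surgery (on a polygon with a site at height `≥ L + 2`; the surgery touches heights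
`≤ L` only) or a floor surgery (site at height `≥ L + 3`; heights `≤ L + 1` touched), with the facts the decoding lemmas consume.
[cite: MadrasSlade1993, §3.2 (proof of Theorem 3.2.3)] -/
def BottomDatum (n : ℕ) (ω W : ℕ → Site 2) (L xb : ℤ) (j k : ℕ) (fwd : Bool) : Prop :=
  ((∃ i, i ≤ n ∧ L + 2 ≤ ω i 1) ∧ SpliceAddOK n 2 2 ω j (tpath offXb 4 xb L fwd) ∧ (∀ s, s ≤ 2 → ω (j + s) = tpath w6A 2 xb L fwd s) ∧
      (fwd = true → ω (j + 3) = pt xb L) ∧ (fwd = false → 1 ≤ j ∧ ω (j - 1) = pt xb L) ∧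
      W = spliceAdd 2 2 ω (tpath offXb 4 xb L fwd) j) ∨
    (1 ≤ k ∧ (∃ i, i ≤ n ∧ L + 3 ≤ ω i 1) ∧ SpliceAddOK n 2 (2 * k) ω j (tpath (offYsb k) (2 * k + 2) xb L fwd) ∧
      (∀ s, s ≤ 2 * k → ω (j + s) = tpath wYsb (2 * k) xb L fwd s) ∧
      (fwd = true → 3 ≤ j ∧ ω (j - 1) = pt (xb - 1) L ∧ ω (j - 2) = pt (xb - 2) L ∧ ω (j - 3) = pt (xb - 2) (L + 1)) ∧
      (fwd = false → ω (j + 2 * k + 1) = pt (xb - 1) L ∧ (j + 2 * k + 2 ≤ n →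
        ω (j + 2 * k + 2) = pt (xb - 2) L ∧ ω (j + 2 * k + 3) = pt (xb - 2) (L + 1))) ∧
      W = spliceAdd 2 (2 * k) ω (tpath (offYsb k) (2 * k + 2) xb L fwd) j)

/-- **An image with its decoding datum** for every polygon of the bottom class (the depth witnesses travel inside the datum).
[cite: MadrasSlade1993, §3.2 (proof of Theorem 3.2.3)] -/
theorem exists_stepTwoBottom_image (hω : ω ∈ canonEnd n) (hn : 5 ≤ n) (hm : IsStepTwoBottom n ω) :
    ∃ W : ℕ → Site 2, W ∈ canonEnd (n + 2) ∧ ∃ (L xb : ℤ) (j k : ℕ) (fwd : Bool),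
      (∀ i, i ≤ n → L ≤ ω i 1) ∧ (∀ i, i ≤ n → ω i 1 = L → ω i 0 ≤ xb) ∧ BottomDatum n ω W L xb j k fwd := by
  obtain ⟨L, xb, i₀, hi₀n, hv, hx2, hdeep, hminH, hmaxX, hcase⟩ := hm
  rcases hcase with hX | ⟨hdeep3, hi₀3, p1, p2, p3, k, hk, hkn, hrun, hup⟩ | ⟨hdeep3, p1, p23, k, hk, hki, hrun, hup⟩
  · obtain ⟨j, fwd, hP, hw, hvf, hvb⟩ := stepTwo_data_Xb hω (by omega) hminH hmaxX ⟨i₀, by omega, hv⟩ hX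
    exact ⟨_, spliceAdd_mem_canonEnd hω hP, L, xb, j, 0, fwd, hminH, hmaxX, Or.inl ⟨hdeep, hP, hw, hvf, hvb, rfl⟩⟩
  · obtain ⟨hP, hw⟩ := stepTwo_data_Ysb_fwd hω hx2 hk hkn hminH hmaxX hv hrun hup
    exact ⟨_, spliceAdd_mem_canonEnd hω hP, L, xb, i₀, k, true, hminH, hmaxX,
      Or.inr ⟨hk, hdeep3, hP, hw, fun _ => ⟨hi₀3, p1, p2, p3⟩, fun h => absurd h (by decide), rfl⟩⟩
  · obtain ⟨hP, hw⟩ := stepTwo_data_Ysb_bwd hω hx2 hk hki (by omega) hminH hmaxX hv hrun hup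
    refine ⟨_, spliceAdd_mem_canonEnd hω hP, L, xb, i₀ - 2 * k, k, false, hminH, hmaxX,
      Or.inr ⟨hk, hdeep3, hP, hw, fun h => absurd h (by decide), fun _ => ⟨?_, fun hle => ⟨?_, ?_⟩⟩, rfl⟩⟩
    · rw [show i₀ - 2 * k + 2 * k + 1 = i₀ + 1 by omega, p1]
    · rw [show i₀ - 2 * k + 2 * k + 2 = i₀ + 2 by omega]; exact (p23 (by omega)).1
    · rw [show i₀ - 2 * k + 2 * k + 3 = i₀ + 3 by omega]; exact (p23 (by omega)).2.2

/-- **Decoding of bottom images is datum-free.** [cite: MadrasSlade1993, §3.2 (proof of Theorem 3.2.3: "Q can be unambiguously determined")] -/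
theorem eq_of_stepTwoBottom_image_eq {ω₁ ω₂ W : ℕ → Site 2} (hω₁ : ω₁ ∈ canonEnd n) (hω₂ : ω₂ ∈ canonEnd n)
    {L₁ xb₁ : ℤ} {j₁ k₁ : ℕ} {fwd₁ : Bool} {L₂ xb₂ : ℤ} {j₂ k₂ : ℕ} {fwd₂ : Bool}
    (hminH₁ : ∀ i, i ≤ n → L₁ ≤ ω₁ i 1) (hmaxX₁ : ∀ i, i ≤ n → ω₁ i 1 = L₁ → ω₁ i 0 ≤ xb₁)
    (hminH₂ : ∀ i, i ≤ n → L₂ ≤ ω₂ i 1) (hmaxX₂ : ∀ i, i ≤ n → ω₂ i 1 = L₂ → ω₂ i 0 ≤ xb₂)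
    (h₁ : BottomDatum n ω₁ W L₁ xb₁ j₁ k₁ fwd₁) (h₂ : BottomDatum n ω₂ W L₂ xb₂ j₂ k₂ fwd₂) : ω₁ = ω₂ := by
  rcases h₁ with ⟨-, hP₁, hw₁, hvf₁, hvb₁, rfl⟩ | ⟨hk₁, -, hP₁, hw₁, hpre₁, hpost₁, rfl⟩ <;>
    rcases h₂ with ⟨-, hP₂, hw₂, hvf₂, hvb₂, h⟩ | ⟨hk₂, -, hP₂, hw₂, hpre₂, hpost₂, h⟩
  · exact spliceXb_decode hω₁ hω₂ hminH₁ hmaxX₁ hminH₂ hmaxX₂ hP₁ hP₂ hw₁ hw₂ hvf₁ hvf₂ hvb₁ hvb₂ h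
  · exact (spliceXb_ne_spliceYsb hω₁ hk₂ hminH₁ hmaxX₁ hminH₂ hmaxX₂ hP₁ hP₂ hvf₁ hvb₁ h).elim
  · exact (spliceXb_ne_spliceYsb hω₂ hk₁ hminH₂ hmaxX₂ hminH₁ hmaxX₁ hP₂ hP₁ hvf₂ hvb₂ h.symm).elim
  · exact spliceYsb_decode hω₁ hω₂ hk₁ hk₂ hminH₁ hmaxX₁ hminH₂ hmaxX₂ hP₁ hP₂ hw₁ hw₂ hpre₁ hpost₁ hpre₂ hpost₂ h

end BottomClass

/-! ### Cross lemmas: top images are never in the leaf class; bottom images of deep leaf polygons stay in it -/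

section Cross

/-- A leaf datum of a walk gives its intrinsic top corner. [cite: MadrasSlade1993, §3.2 (proof of Theorem 3.2.3)] -/
theorem topSix_of_isTopLeaf {N : ℕ} {W : ℕ → Site 2} (h : IsTopLeaf N W) :
    ∃ (H xm : ℤ) (i₀ : ℕ), TopSix N W H xm i₀ ∧ (∀ t, t ≤ N → W t ≠ pt (xm - 3) H) ∧
      ((i₀ + 2 ≤ N ∧ W (i₀ + 1) = pt xm (H - 1) ∧ W (i₀ + 2) = pt (xm - 1) (H - 1)) ∨
        (2 ≤ i₀ ∧ W (i₀ - 1) = pt xm (H - 1) ∧ W (i₀ - 2) = pt (xm - 1) (H - 1))) := by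
  obtain ⟨H, xm, i₀, hi₀n, hv, -, hmaxH, hmaxX, hX, hpat⟩ := h
  exact ⟨H, xm, i₀, ⟨hmaxH, hmaxX, by omega, hv⟩, hX, hpat⟩

/-- **A top image is not in the leaf class.**  For a case-X image the site two steps below its corner (in time) is the OLD corner, to the
RIGHT; for a roof image the site `(x'−3, H')` lies on the image (on the roof for `k ≥ 2`, the old corner's left neighbour for `k = 1`).
[cite: MadrasSlade1993, §3.2 (proof of Theorem 3.2.3)] -/
theorem not_isTopLeaf_of_roofDatum {W : ℕ → Site 2} {H xm : ℤ} {j k : ℕ} {fwd : Bool} (hω : ω ∈ canonEnd n) (hn : 2 ≤ n)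
    (hmaxH : ∀ i, i ≤ n → ω i 1 ≤ H) (hmaxX : ∀ i, i ≤ n → ω i 1 = H → ω i 0 ≤ xm)
    (hd : RoofDatum n ω W H xm j k fwd) : ¬ IsTopLeaf (n + 2) W := by
  intro hleaf
  obtain ⟨hE, -⟩ := mem_canonEnd.1 hω
  obtain ⟨H', x', τ, T', hX', hpat⟩ := topSix_of_isTopLeaf hleaf
  rcases hd with ⟨hP, hw, hvf, hvb, rfl⟩ | ⟨hk, hP, hw, hpre, hpost, rfl⟩
  · -- case X image: corner `(xm−1, H+1)` at `j + rd fwd 4 3`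
    have hW := spliceAdd_mem hE hP
    have hinj := (mem_endAt_iff.1 hW).1.2.2.2
    obtain ⟨eH, ex, eτ⟩ := topAt_unique hinj (topAt_spliceX hmaxH hmaxX hP) T'
    cases fwd <;> simp only [rd, Bool.false_eq_true, ↓reduceIte] at eτ
    · -- backward: W(j−1) = (xm,H) [old corner], W(j) = (xm−1,H), corner at j+1, W(j+2) = (xm−2,H+1)
      obtain ⟨hj, hv⟩ := hvb rfl
      obtain ⟨e1, e0, -⟩ := spliceX_signature_bwd hP hj hv
      have e2 : spliceAdd 2 2 ω (tpath offX 4 xm H false) j (j + 2) = pt (xm - 2) (H + 1) := by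
        rw [spliceAdd_mid hP.start (by norm_num)]; simp [tpath, rd, offX]; ring_nf
      rcases hpat with ⟨-, h1, -⟩ | ⟨-, -, h2⟩
      · rw [← eτ, show j + 1 + 1 = j + 2 by omega, e2] at h1; have := (pt_inj.1 h1).2; omega
      · rw [← eτ, show j + 1 - 2 = j - 1 by omega, e1] at h2; have := (pt_inj.1 h2).1; omega
    · -- forward: corner at j+3, W(j+4) = (xm−1,H), W(j+5) = (xm,H); W(j+2) = (xm−2,H+1)
      obtain ⟨-, h4, h5⟩ := spliceX_signature_fwd hP (hvf rfl)
      have e2 : spliceAdd 2 2 ω (tpath offX 4 xm H true) j (j + 2) = pt (xm - 2) (H + 1) := by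
        rw [spliceAdd_mid hP.start (by norm_num)]; simp [tpath, rd, offX]; ring_nf
      rcases hpat with ⟨-, -, h2⟩ | ⟨-, h1, -⟩
      · rw [← eτ, show j + 3 + 2 = j + 5 by omega, h5] at h2; have := (pt_inj.1 h2).1; omega
      · rw [← eτ, show j + 3 - 1 = j + 2 by omega, e2] at h1; have := (pt_inj.1 h1).2; omega
  · -- roof image: corner `(xm+2k, H)`; the site `(xm+2k−3, H)` is on the image
    have hW := spliceAdd_mem hE hP
    have hfr := (mem_endAt_iff.1 hE).1.2.1
    have hinj := (mem_endAt_iff.1 hW).1.2.2.2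
    obtain ⟨eH, ex, eτ⟩ := topAt_unique hinj (topAt_spliceYs hmaxH hmaxX hP) T'
    have hx' : x' - 3 = xm + 2 * k - 3 := by omega
    have hH' : H' = H := by omega
    simp only [hx', hH'] at hX'
    have hwnd := hP.wnd
    have hH1 : 1 ≤ H := by
      have h1 := apply_one_of_mem_canonEnd hω hn
      have := hmaxH 1 (by omega); rw [h1.2] at this; exact this
    obtain ⟨t, ht, e⟩ : ∃ t, t ≤ n + 2 ∧ spliceAdd 2 (2 * k) ω (tpath (offYs k) (2 * k + 2) xm H fwd) j t = pt (xm + 2 * k - 3) H := by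
      cases fwd
      · -- backward: roof sites at times `j+2+u` are `(xm+2k−u, H)`; for `k = 1` use `ω (j+2k+1) = (xm−1,H)` at image time `j+2k+3`
        rcases Nat.lt_or_ge k 2 with hk1 | hk2
        · obtain ⟨q1, -, -⟩ := hpost rfl
          -- the index `j + 2k + 1` is a genuine time: otherwise `ω` is frozen at `e₀`, of height `0 < H`
          have hb : j + 2 * k + 1 ≤ n := by
            by_contra hlt
            rw [hfr (j + 2 * k + 1) (by omega), (mem_endAt_iff.1 hE).2] at q1
            have := congrFun q1 1; simp at this; omega
          refine ⟨j + 2 * k + 3, by omega, ?_⟩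
          rw [spliceAdd_of_ge hP.finish (by omega), show j + 2 * k + 3 - 2 = j + 2 * k + 1 by omega, q1]
          exact pt_inj.2 ⟨by omega, rfl⟩
        · exact ⟨j + (2 + 3), by omega, by exact_mod_cast (spliceYs_sites_bwd hP).1 3 (by omega)⟩
      · rcases Nat.lt_or_ge k 2 with hk1 | hk2
        · obtain ⟨hj3, q1, -, -⟩ := hpre rfl
          refine ⟨j - 1, by omega, ?_⟩
          rw [spliceAdd_of_le (by omega), q1]
          exact pt_inj.2 ⟨by omega, rfl⟩
        · have e := (spliceYs_sites_fwd hP).1 (2 * k - 3) (by omega)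
          refine ⟨j + (2 * k - 3), by omega, ?_⟩
          rw [e]; exact pt_inj.2 ⟨by omega, rfl⟩
    exact hX' t ht e

/-- **The bottom image of a leaf polygon is in the leaf class**: the bottom surgery of a `BottomDatum` changes sites of heights `≤ B`
only (`B = L` for case X♭, `B = L + 1` for the floor move) on a polygon with a site at height `≥ B + 2`, while the leaf pattern lives at
heights `≥ H − 1 ≥ B + 1`, so the leaf datum is carried to the image (with the corner time shifted by `2` when the window precedes it).
[cite: MadrasSlade1993, §3.2 (proof of Theorem 3.2.3)] -/
theorem isTopLeaf_of_bottomDatum {W : ℕ → Site 2} {L xb : ℤ} {j k : ℕ} {fwd : Bool} (hω : ω ∈ canonEnd n)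
    (hd : BottomDatum n ω W L xb j k fwd) (hleaf : IsTopLeaf n ω) : IsTopLeaf (n + 2) W := by
  obtain ⟨hE, -⟩ := mem_canonEnd.1 hω
  obtain ⟨H, xm, t₀, ht₀n, hv, hx2, hmaxH, hmaxX, hX, hpat⟩ := hleaf
  -- a uniform package: a height bound `B` with `B + 2 ≤ H`, window length `Lw`, the splice facts, new sites and window sites of height `≤ B`
  have pack : ∃ (B : ℤ) (Lw : ℕ) (π : ℕ → Site 2), B + 2 ≤ H ∧ SpliceAddOK n 2 Lw ω j π ∧ W = spliceAdd 2 Lw ω π j ∧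
      (∀ s, s ≤ Lw + 2 → π s 1 ≤ B) ∧ (∀ s, s ≤ Lw → ω (j + s) 1 ≤ B) := by
    rcases hd with ⟨⟨i₁, hi₁, hdeep⟩, hP, hw, -, -, rfl⟩ | ⟨hk, ⟨i₁, hi₁, hdeep⟩, hP, hw, -, -, rfl⟩
    · refine ⟨L, 2, _, le_trans hdeep (hmaxH i₁ hi₁), hP, rfl, fun s hs => ?_, fun s hs => ?_⟩
      · obtain ⟨u, hu, e⟩ := tpath_mem (off := offXb) (K := 4) (xm := xb) (H := L) (fwd := fwd) (s := s) hs
        rw [e, pt_apply_one]; interval_cases u <;> simp [offXb]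
      · rw [hw s hs]
        obtain ⟨u, hu, e⟩ := tpath_mem (off := w6A) (K := 2) (xm := xb) (H := L) (fwd := fwd) (s := s) hs
        rw [e, pt_apply_one]; interval_cases u <;> simp [w6A]
    · refine ⟨L + 1, 2 * k, _, by have := hmaxH i₁ hi₁; omega, hP, rfl, fun s hs => ?_, fun s hs => ?_⟩
      · obtain ⟨u, hu, e⟩ := tpath_mem (off := offYsb k) (K := 2 * k + 2) (xm := xb) (H := L) (fwd := fwd) (s := s) hs
        rw [e, pt_apply_one]; unfold offYsb; split_ifs <;> simp
      · rw [hw s hs]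
        obtain ⟨u, hu, e⟩ := tpath_mem (off := wYsb) (K := 2 * k) (xm := xb) (H := L) (fwd := fwd) (s := s) hs
        rw [e, pt_apply_one]; unfold wYsb; split_ifs <;> simp
  obtain ⟨B, Lw, π, hBH, hP, rfl, hπ, hwin⟩ := pack
  have hwnd := hP.wnd
  -- sites of the image: old sites keep their heights `≤ H`; new ones have height `≤ B < H − 1`
  have site : ∀ i, i ≤ n + 2 →
      (∃ a, a ≤ n ∧ (a ≤ j ∨ j + Lw ≤ a) ∧ spliceAdd 2 Lw ω π j i = ω a) ∨ spliceAdd 2 Lw ω π j i 1 ≤ B := by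
    intro i hi
    rcases spliceAdd_site_cases hP hi with h | ⟨s, hs, e⟩
    · exact Or.inl h
    · right; rw [e]; exact hπ s hs
  have hmaxH' : ∀ i, i ≤ n + 2 → spliceAdd 2 Lw ω π j i 1 ≤ H := by
    intro i hi
    rcases site i hi with ⟨a, ha, -, e⟩ | h
    · rw [e]; exact hmaxH a ha
    · omega
  have hmaxX' : ∀ i, i ≤ n + 2 → spliceAdd 2 Lw ω π j i 1 = H → spliceAdd 2 Lw ω π j i 0 ≤ xm := by
    intro i hi hiH
    rcases site i hi with ⟨a, ha, -, e⟩ | h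
    · rw [e] at hiH ⊢; exact hmaxX a ha hiH
    · omega
  have hX' : ∀ t, t ≤ n + 2 → spliceAdd 2 Lw ω π j t ≠ pt (xm - 3) H := by
    intro t ht e
    rcases site t ht with ⟨a, ha, -, e'⟩ | h
    · exact hX a ha (e'.symm.trans e)
    · rw [e, pt_apply_one] at h; omega
  -- the leaf block (heights `≥ H − 1`) avoids the window times `j … j + Lw` (heights `≤ B`)
  have notwin : ∀ t, t ≤ n → H - 1 ≤ ω t 1 → t < j ∨ j + Lw < t := by
    intro t ht hth
    by_contra hcon
    push Not at hcon
    obtain ⟨s, rfl⟩ : ∃ s, t = j + s := ⟨t - j, by omega⟩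
    have := hwin s (by omega); omega
  have hvH : H - 1 ≤ ω t₀ 1 := by rw [hv]; simp
  rcases hpat with ⟨ht2, h1, h2⟩ | ⟨ht2, h1, h2⟩
  · -- forward leaf block `t₀, t₀+1, t₀+2`
    have g1 : H - 1 ≤ ω (t₀ + 1) 1 := by rw [h1]; simp
    have g2 : H - 1 ≤ ω (t₀ + 2) 1 := by rw [h2]; simp
    rcases notwin t₀ (by omega) hvH with hlt | hgt
    · -- whole block before the window: need `t₀ + 2 ≤ j` (else `t₀+1` or `t₀+2` would be a window time)
      have hb1 := notwin (t₀ + 1) (by omega) g1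
      have hb2 := notwin (t₀ + 2) (by omega) g2
      have ht2j : t₀ + 2 ≤ j := by omega
      refine ⟨H, xm, t₀, by omega, ?_, hx2, hmaxH', hmaxX', hX', Or.inl ⟨by omega, ?_, ?_⟩⟩
      · rw [spliceAdd_of_le (by omega), hv]
      · rw [spliceAdd_of_le (by omega), h1]
      · rw [spliceAdd_of_le ht2j, h2]
    · refine ⟨H, xm, t₀ + 2, by omega, ?_, hx2, hmaxH', hmaxX', hX', Or.inl ⟨by omega, ?_, ?_⟩⟩
      · rw [spliceAdd_of_ge hP.finish (by omega), show t₀ + 2 - 2 = t₀ by omega, hv]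
      · rw [spliceAdd_of_ge hP.finish (by omega), show t₀ + 2 + 1 - 2 = t₀ + 1 by omega, h1]
      · rw [spliceAdd_of_ge hP.finish (by omega), show t₀ + 2 + 2 - 2 = t₀ + 2 by omega, h2]
  · -- backward leaf block `t₀−2, t₀−1, t₀`
    have g1 : H - 1 ≤ ω (t₀ - 1) 1 := by rw [h1]; simp
    have g2 : H - 1 ≤ ω (t₀ - 2) 1 := by rw [h2]; simp
    rcases notwin t₀ (by omega) hvH with hlt | hgt
    · refine ⟨H, xm, t₀, by omega, ?_, hx2, hmaxH', hmaxX', hX', Or.inr ⟨ht2, ?_, ?_⟩⟩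
      · rw [spliceAdd_of_le (by omega), hv]
      · rw [spliceAdd_of_le (by omega), h1]
      · rw [spliceAdd_of_le (by omega), h2]
    · have hb1 := notwin (t₀ - 1) (by omega) g1
      have hb2 := notwin (t₀ - 2) (by omega) g2
      have ht2j : j + Lw + 2 ≤ t₀ := by omega
      refine ⟨H, xm, t₀ + 2, by omega, ?_, hx2, hmaxH', hmaxX', hX', Or.inr ⟨by omega, ?_, ?_⟩⟩
      · rw [spliceAdd_of_ge hP.finish (by omega), show t₀ + 2 - 2 = t₀ by omega, hv]
      · rw [spliceAdd_of_ge hP.finish (by omega), show t₀ + 2 - 1 - 2 = t₀ - 1 by omega, h1]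
      · rw [spliceAdd_of_ge hP.finish (by omega), show t₀ + 2 - 2 - 2 = t₀ - 2 by omega, h2]

end Cross

/-! ### The two-corner injection -/

section TwoCorner

/-- **The class served by the two corners**: class X ∪ Y⋆ at the top, or the leaf class served at the bottom.
[cite: MadrasSlade1993, §3.2 (proof of Theorem 3.2.3)] -/
def IsStepTwoTwoCorner (n : ℕ) (ω : ℕ → Site 2) : Prop := IsStepTwoRoof n ω ∨ (IsTopLeaf n ω ∧ IsStepTwoBottom n ω)

/-- **★ The step two holds on the two-corner class**: the canonical rooted `(n+1)`-gons (`n ≥ 5`) of class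
X ∪ Y⋆ ∪ (leaf ∩ bottom-served) inject into the canonical rooted `(n+3)`-gons. [cite: MadrasSlade1993, §3.2, Theorem 3.2.3 / (3.2.3) (the `ℤ^d` statement being transplanted)] -/
theorem card_filter_isStepTwoTwoCorner_le [DecidablePred (IsStepTwoTwoCorner n)] (hn : 5 ≤ n) :
    #((canonEnd n).filter (IsStepTwoTwoCorner n)) ≤ #(canonEnd (n + 2)) := by
  classical
  let E : (ℕ → Site 2) → (ℕ → Site 2) := fun ω =>
    if h : ω ∈ canonEnd n ∧ IsStepTwoRoof n ω then Classical.choose (exists_stepTwoRoof_image h.1 hn h.2)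
    else if h' : ω ∈ canonEnd n ∧ IsTopLeaf n ω ∧ IsStepTwoBottom n ω then
      Classical.choose (exists_stepTwoBottom_image h'.1 hn h'.2.2)
    else ω
  have hE1 : ∀ ω, ∀ h : ω ∈ canonEnd n ∧ IsStepTwoRoof n ω, E ω = Classical.choose (exists_stepTwoRoof_image h.1 hn h.2) :=
    fun ω h => dif_pos h
  have hE2 : ∀ ω, ω ∈ canonEnd n → ¬ IsStepTwoRoof n ω → ∀ h' : ω ∈ canonEnd n ∧ IsTopLeaf n ω ∧ IsStepTwoBottom n ω,
      E ω = Classical.choose (exists_stepTwoBottom_image h'.1 hn h'.2.2) := by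
    intro ω hω hnot h'
    show (if h : ω ∈ canonEnd n ∧ IsStepTwoRoof n ω then _ else _) = _
    rw [dif_neg (fun h => hnot h.2), dif_pos h']
  -- the two kinds of images
  have himgR : ∀ ω (h : ω ∈ canonEnd n ∧ IsStepTwoRoof n ω), E ω ∈ canonEnd (n + 2) ∧ ¬ IsTopLeaf (n + 2) (E ω) ∧
      ∃ (H xm : ℤ) (j k : ℕ) (fwd : Bool), (∀ i, i ≤ n → ω i 1 ≤ H) ∧ (∀ i, i ≤ n → ω i 1 = H → ω i 0 ≤ xm) ∧
        RoofDatum n ω (E ω) H xm j k fwd := by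
    intro ω h
    rw [hE1 ω h]
    obtain ⟨hW, H, xm, j, k, fwd, hmaxH, hmaxX, hd⟩ := Classical.choose_spec (exists_stepTwoRoof_image h.1 hn h.2)
    exact ⟨hW, not_isTopLeaf_of_roofDatum h.1 (by omega) hmaxH hmaxX hd, H, xm, j, k, fwd, hmaxH, hmaxX, hd⟩
  have himgB : ∀ ω, ω ∈ canonEnd n → ¬ IsStepTwoRoof n ω → ∀ h' : ω ∈ canonEnd n ∧ IsTopLeaf n ω ∧ IsStepTwoBottom n ω,
      E ω ∈ canonEnd (n + 2) ∧ IsTopLeaf (n + 2) (E ω) ∧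
      ∃ (L xb : ℤ) (j k : ℕ) (fwd : Bool), (∀ i, i ≤ n → L ≤ ω i 1) ∧ (∀ i, i ≤ n → ω i 1 = L → ω i 0 ≤ xb) ∧
        BottomDatum n ω (E ω) L xb j k fwd := by
    intro ω hω hnot h'
    rw [hE2 ω hω hnot h']
    obtain ⟨hW, L, xb, j, k, fwd, hminH, hmaxX, hd⟩ :=
      Classical.choose_spec (exists_stepTwoBottom_image h'.1 hn h'.2.2)
    exact ⟨hW, isTopLeaf_of_bottomDatum h'.1 hd h'.2.1, L, xb, j, k, fwd, hminH, hmaxX, hd⟩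
  refine Finset.card_le_card_of_injOn E (fun ω hω => ?_) (fun ω₁ hω₁ ω₂ hω₂ heq => ?_)
  · rw [Finset.mem_coe, Finset.mem_filter] at hω
    rw [Finset.mem_coe]
    by_cases hR : IsStepTwoRoof n ω
    · exact (himgR ω ⟨hω.1, hR⟩).1
    · rcases hω.2 with hR' | ⟨hl, hb⟩
      · exact absurd hR' hR
      · exact (himgB ω hω.1 hR ⟨hω.1, hl, hb⟩).1
  · rw [Finset.mem_coe, Finset.mem_filter] at hω₁ hω₂
    by_cases hR₁ : IsStepTwoRoof n ω₁ <;> by_cases hR₂ : IsStepTwoRoof n ω₂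
    · obtain ⟨-, -, H₁, xm₁, j₁, k₁, fwd₁, hmaxH₁, hmaxX₁, h₁⟩ := himgR ω₁ ⟨hω₁.1, hR₁⟩
      obtain ⟨-, -, H₂, xm₂, j₂, k₂, fwd₂, hmaxH₂, hmaxX₂, h₂⟩ := himgR ω₂ ⟨hω₂.1, hR₂⟩
      rw [heq] at h₁
      exact eq_of_stepTwoRoof_image_eq hω₁.1 hω₂.1 hmaxH₁ hmaxX₁ hmaxH₂ hmaxX₂ h₁ h₂
    · exfalso
      have hb₂ : IsTopLeaf n ω₂ ∧ IsStepTwoBottom n ω₂ := by rcases hω₂.2 with h | h; exact absurd h hR₂; exact h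
      obtain ⟨-, hnl, -⟩ := himgR ω₁ ⟨hω₁.1, hR₁⟩
      obtain ⟨-, hl, -⟩ := himgB ω₂ hω₂.1 hR₂ ⟨hω₂.1, hb₂⟩
      rw [heq] at hnl
      exact hnl hl
    · exfalso
      have hb₁ : IsTopLeaf n ω₁ ∧ IsStepTwoBottom n ω₁ := by rcases hω₁.2 with h | h; exact absurd h hR₁; exact h
      obtain ⟨-, hnl, -⟩ := himgR ω₂ ⟨hω₂.1, hR₂⟩
      obtain ⟨-, hl, -⟩ := himgB ω₁ hω₁.1 hR₁ ⟨hω₁.1, hb₁⟩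
      rw [← heq] at hnl
      exact hnl hl
    · have hb₁ : IsTopLeaf n ω₁ ∧ IsStepTwoBottom n ω₁ := by rcases hω₁.2 with h | h; exact absurd h hR₁; exact h
      have hb₂ : IsTopLeaf n ω₂ ∧ IsStepTwoBottom n ω₂ := by rcases hω₂.2 with h | h; exact absurd h hR₂; exact h
      obtain ⟨-, -, L₁, xb₁, j₁, k₁, fwd₁, hminH₁, hmaxX₁, h₁⟩ := himgB ω₁ hω₁.1 hR₁ ⟨hω₁.1, hb₁⟩
      obtain ⟨-, -, L₂, xb₂, j₂, k₂, fwd₂, hminH₂, hmaxX₂, h₂⟩ := himgB ω₂ hω₂.1 hR₂ ⟨hω₂.1, hb₂⟩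
      rw [heq] at h₁
      exact eq_of_stepTwoBottom_image_eq hω₁.1 hω₂.1 hminH₁ hmaxX₁ hminH₂ hmaxX₂ h₁ h₂

/-- **Complement form**: `#canonEnd n − #{leaf polygons NOT served at the bottom} ≤ #canonEnd (n+2)` — the step two
`q_{n+1}(ℍ) ≤ q_{n+3}(ℍ)` would follow from an injection of this two-corner residue (top leaf ∧ bottom leaf, numerically) into the
unused images. [cite: MadrasSlade1993, §3.2, Theorem 3.2.3 / (3.2.3)] -/
theorem card_canonEnd_sub_card_filter_twoCornerResidue_le [DecidablePred (IsStepTwoTwoCorner n)]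
    [DecidablePred fun ω => IsTopLeaf n ω ∧ ¬ IsStepTwoBottom n ω] (hn : 5 ≤ n) :
    #(canonEnd n) - #((canonEnd n).filter fun ω => IsTopLeaf n ω ∧ ¬ IsStepTwoBottom n ω) ≤ #(canonEnd (n + 2)) := by
  classical
  have hcover : canonEnd n ⊆ (canonEnd n).filter (IsStepTwoTwoCorner n) ∪
      (canonEnd n).filter (fun ω => IsTopLeaf n ω ∧ ¬ IsStepTwoBottom n ω) := by
    intro ω hω
    rcases isStepTwoRoof_or_isTopLeaf hω hn with h | h
    · exact Finset.mem_union_left _ (Finset.mem_filter.2 ⟨hω, Or.inl h⟩)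
    · by_cases hb : IsStepTwoBottom n ω
      · exact Finset.mem_union_left _ (Finset.mem_filter.2 ⟨hω, Or.inr ⟨h, hb⟩⟩)
      · exact Finset.mem_union_right _ (Finset.mem_filter.2 ⟨hω, h, hb⟩)
  have h1 := (Finset.card_le_card hcover).trans (Finset.card_union_le _ _)
  have h2 := card_filter_isStepTwoTwoCorner_le (n := n) hn
  omega

/-- **Printed normalisation**: `q_{n+1}(ℍ) − #{two-corner residue} ≤ q_{n+3}(ℍ)` (`n ≥ 5`).
[cite: MadrasSlade1993, §3.2, Theorem 3.2.3 / (3.2.3)] -/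
theorem hexPolygonNumber_sub_card_twoCornerResidue_le [DecidablePred fun ω => IsTopLeaf n ω ∧ ¬ IsStepTwoBottom n ω] (hn : 5 ≤ n) :
    hexPolygonNumber (n + 1) - #((canonEnd n).filter fun ω => IsTopLeaf n ω ∧ ¬ IsStepTwoBottom n ω) ≤ hexPolygonNumber (n + 3) := by
  classical
  have h := card_canonEnd_sub_card_filter_twoCornerResidue_le (n := n) hn
  rw [card_canonEnd (by omega), card_canonEnd (by omega)] at h
  exact h

/-- The two-corner class contains the class X ∪ Y⋆ of `HexSAWPolygonStepTwoYStar` (hence the main class of `HexSAWPolygonStepTwoMain`).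
[cite: MadrasSlade1993, §3.2 (proof of Theorem 3.2.3)] -/
theorem card_filter_isStepTwoRoof_le_card_filter_isStepTwoTwoCorner [DecidablePred (IsStepTwoRoof n)]
    [DecidablePred (IsStepTwoTwoCorner n)] :
    #((canonEnd n).filter (IsStepTwoRoof n)) ≤ #((canonEnd n).filter (IsStepTwoTwoCorner n)) :=
  Finset.card_le_card fun ω hω => by
    rw [Finset.mem_filter] at hω ⊢
    exact ⟨hω.1, Or.inl hω.2⟩

end TwoCorner

end PolygonConcat

end HexBW

end Literature.Probability.RandomPlanarGeometry.SAW

end
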